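import Summits.QuantumFields.YangMills.Theorems.BalabanLadderIROddTorusLargeFieldRaritySharp
import Summits.QuantumFields.YangMills.Theorems.EquipartitionCriticalityFreeEnergyLogCoefficient
import Literature.MathematicalPhysics.QuantumLattice.LatticeGaugeDLRFreeEnergyProofs
import Literature.MathematicalPhysics.QuantumFieldTheory.WilsonPlaquetteChessboardTail
import Literature.MathematicalPhysics.QuantumFieldTheory.YangMillsOS

/-!
# Line 4 `largefield-rarity-chessboard` — the shared supplier (R) «large-field rarity, Peierls-multiplicative, uniform in β and
# the volume» PROVED on the odd tori of the crux (LINE 3 `Lines/smallfield_polymer_coder.lean`, stub `stub_largeFieldRarity`;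
# NT rows (R)/(B4)) — crux `BalabanLadder.IR` (stmt-QuantumFields-19354), ideator `ym-ir-idea-4` g3 (lens: certified interpolation
# cluster-region → small-field region; here the LARGE-field region is priced against the small-field FREE ENERGY by reflection
# positivity, and the price is made β-uniform by the Gaussian free-energy asymptotics the tree already proves)

MAIN THEOREM (sorry-free; `largeFieldRarity_oddSides`; named statement `LargeFieldRarityOddTori`, witness `largeFieldRarityOddTori_holds`).  For every compact simple Lie
group `G` and lattice representation `r` there are `c > 0`, `A₀`, `β₃` such that for all `A ≥ A₀`, `β ≥ β₃`, every ODD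
torus side `L ≥ 3` above the EXPLICIT volume floor `L ≥ volFloor β = (⌈β⌉₊+2)²` and EVERY plaquette family `Q ⊆ 𝕋⁴_L`:
    `μ_{L,β}{U | ∀ p ∈ Q, s_p(U) > A/(2β)} ≤ exp(−c·A·#Q)`,   `s_p = N − Re tr ρ(U_p)` (the Wilson plaquette cost).
The threshold `A/(2β)` is FIXED in units of `1/β` (no `log β`), the rate `c` and the onset `A₀` do not depend on `β`, `L` or `Q`.
This is the typed content of (R) «large-field rarity, Peierls-multiplicative, uniform in β and the volume» at the sides the
literal crux quantifies over (`2S+1`, `S ≥ 1`), up to the re-typing recorded under CONSUMERS.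

ENGINE (every seam proved in this file; external inputs are TREE THEOREMS, cited by name):
* (CZ on 𝓛) `ChessboardZRatio 𝓛` «chessboard-to-free-energy for EXPONENTIAL plaquette functionals»:
  `⟨∏_{p∈Q} e^{λβ s_p}⟩_{L,β} ≤ exp((log Z_L((1−kλ)β) − log Z_L(β))·#Q/(kL⁴))`.  ODD sides `≥ 3`: `chessboardZRatio_odd` — it IS
  the tree's odd-torus chessboard `OddTorusChessboard.wilsonExpectation_expObs_le_exp_card_all` (seat ym-infvol-p3, 2026-08-27:
  mixed site∕link reflections of the odd torus after Borgs–Seiler, Hölder over the `k = #Orient 4` orientations;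
  Fröhlich–Israel–Lieb–Simon CMP 62 (1978) Thm 4.1).
* (FE∞) `FreeEnergyThermo`: `|f_r(β) + ν log β − K| ≤ 1` for `β ≥ β₃` — `freeEnergyThermo`, from the tree's kernel-checked
  CHATTERJEE THEOREM FOR EVERY COMPACT SIMPLE `G`, `Summit.QuantumFields.YangMills.Theorems.freeEnergyLogCoefficient_proof`
  (crux `FreeEnergyLogCoefficient` of route `EquipartitionCriticality`, stmt-QuantumFields-8759, closed·proved @ c63cf0bd22ae):
  `f_r(β) + (3D/2)·log β → K_r`, `D = dim G` (S. Chatterjee, JFA 2016, Thm 2.1 for `U(N)` [corpus: paper:arxiv-1602.01222 p.4]).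
* (FS) `FiniteSizeFreeEnergy`: `|log Z_L(β) − L⁴ f_r(β)| ≤ C(1+|β|)(L⁴/m + L³m)` — `finiteSizeFreeEnergy`, from the tree's sub-box
  estimate `FreeEnergy.abs_torusLogPartition_sub_le` (Friedli–Velenik Thm 3.6 pattern) used twice (at `(L,m)` and along `L' → ∞`
  against `HasFreeEnergyDensity` ∕ `FreeEnergy.tendsto_div_floor`), the box bounds `FreeEnergy.zdZ_le` ∕ `pow_le_zdZ`, and the
  abstract real lemma `abs_sub_limit_le_of_subbox`.
* (FE) `FreeEnergyIncrement`: `log Z_L(β') − log Z_L(β) ≤ ν₀L⁴log(β/β') + CL⁴` for `β₃ ≤ β' ≤ β`, `L ≥ L₀(β) = (⌈β⌉+2)²` —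
  `freeEnergyIncrement_of_thermo : (FE∞) → (FS) → (FE)` (take `m = ⌈β⌉+2` in (FS): the `(1+β)·L⁴/m` error is `O(L⁴)`).
* `expMomentBound_of_increment : (FE) → (EM)`, `largeFieldRarityOn_of_ZRatio : (CZ on 𝓛) → (FE) → (R on 𝓛)` (exponential
  Chebyshev on `Q` FIRST, then the chessboard, then (FE) at `β' = (1−kθ)β`: the `log β`'s of numerator and denominator CANCEL;
  `c = θ/4`, `A₀ = 4C₁/θ`), `largeFieldRarityEven_of : (CB) → (EM) → (R-even)` for even sides given an indicator chessboard (CB)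
  (`ChessboardEvents`, hypothesis — not needed for the crux's odd tori and NOT stubbed: this file has no `sorry`).

WHY THIS IS THE LINE (and what is new).  The tree's odd-torus Peierls–chessboard rarity (`OddTorusChessboard.measureReal_forall_le_
cellAction_le_pow_rep_sharp`, 2026-08-27) has rate `exp(−λT/m + n(K₀ + D₁ log β)/m)` per cell: its free-energy input is
`Δ_L(λ)/L⁴ ≤ K₀ + D₁ log β` (`torusLogPartition_sub_le_rep` = crude Gaussian lower bound + `log Z ≤ 0`), so at the FIXED threshold
`T = A/(2β)`, `λ = θβ` the base is `e^{−θA/2 + K₀ + D₁ log β} → ∞`: contentful only for thresholds `≳ (log β)/β` (equally: tree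
`WilsonPlaquetteTail.measureReal_plaquette_mem_le`, card `Ideas/odd-chessboard-block-rarity.md` §3).  LINE 3's coder architecture
(fixed `λ` small-field scale `2^λ`, defects = plaquettes with `s_p > A/(2β)`, `A` FIXED) and NT's (R) need the base `e^{−cA}`
UNIFORMLY in `β` — which after the chessboard is EXACTLY a two-sided free-energy increment bound with `O(L⁴)` error, and THAT is
what the tree's Chatterjee theorem (route `EquipartitionCriticality`, dormant) delivers once moved from the thermodynamic limit back
to finite tori by (FS).  The lever: Chatterjee-class free-energy asymptotics as the β-UNIFORMISER of FILS chessboard rarity — a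
junction of two routes (`EquipartitionCriticality.FreeEnergyLogCoefficient` ↔ `BalabanLadder.IR`'s supplier (R)) that nobody had
drawn; free energies do not see the infrared problem (no clustering input, no expansion), so (R) leaves the list of IR-hard
suppliers on the crux's odd tori.  It does NOT touch the IR-hard core (T)/(M-b) of LINE 3 ∕ NT.

RELATION TO `Lines/largefield_rarity_uniform.lean` (ym-ir-idea-5 g6, published 2026-08-28T02:43Z — FIRST; this file was
checked sorry-free at 02:49Z, independently).  SAME LEVER (odd-torus chessboard × the tree's Chatterjee theorem; the `log β`'s
cancel), found by two seats within minutes; idea-5's priority on the lever is acknowledged and its statement `LargeFieldRarityFrom`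
is re-proved here (`largeFieldRarityFrom_holds'`).  What THIS file adds: (a) the finite-size THEOREM (FS) `finiteSizeFreeEnergy`
(`|log Z_L − L⁴f| ≤ C(1+|β|)(L⁴/m + L³m)`), whence an EXPLICIT volume floor `volFloor β = (⌈β⌉₊+2)²` in place of the non-explicit
`S₁(β)` of the pointwise thermodynamic limit (idea-5's «delta 2 … NOT done here», in polynomial form; `(log β)^{1/4}` or no floor
at all remain open: zero-mode bookkeeping on small tori); (b) constants `(c, β₃, floor)` UNIFORM in `A ≥ A₀` (one rate `c = θ/4`);
(c) the increment (FE) for EVERY pair `β₃ ≤ β' ≤ β` (not only doubling) and exponential moments (EM) of `λβ·Σ_{p∈F} s_p` for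
arbitrary plaquette families; (d) a parity-agnostic engine `(CZ on 𝓛) → (FE) → (R on 𝓛)` with the even-side output modulo an
indicator chessboard (CB), for the class-parametric leg.  One statement, two kernel-checked proofs; the consumer-side re-typing
of LINE 3's (R) is done in `Lines/smallfield_polymer_coder.lean` rev 3 (this seat).

BELOW THE FLOOR (§8).  The engine is stated for a GENERAL floor `fl : ℝ → ℕ`; the typed residual (FE<) `FreeEnergyIncrementBelow`
(the increment bound on tori `L < (⌈β⌉₊+2)²`: finite-torus Laplace asymptotics with an `O(L⁴)`-sharp mode count — OPEN, research M)
gives (FE) at floor `0` (`freeEnergyIncrementFrom_zero_of_below`) and hence LINE 3's re-typed (R) on ALL odd tori `≥ 3`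
(`largeFieldRarityAllOddTori_of_below`) and its (R<) (`largeFieldRaritySmallTori_of_below`) BY NAME: the rarity question for
`BalabanLadder.IR`'s (M-c) is reduced to ONE free-energy statement on small tori.

CONSUMERS (honest).  (i) LINE 3's literal `stub_largeFieldRarity` (= `LargeFieldRarityOdd` below: ALL odd tori incl. `S = 0`,
`∀ A > 0 ∃ c`, no volume floor) is NOT literally implied: the theorem gives `∃ A₀ ∀ A ≥ A₀` with one rate `c`, sides `≥ 3`, floor
`L ≥ volFloor β = (⌈β⌉₊+2)²`; all three relaxations are what (M-b)'s Peierls count of SPARSE defects on tori `≥ M₁(β)` consumes — recommended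
re-typing of LINE 3's (R) to `LargeFieldRarityOn {L | Odd L ∧ 3 ≤ L}` (this file's `largeFieldRarity_oddSides` then discharges it),
not applied here (LINE 3 is g2's registered skeleton; critics ∕ g4 decide).  (ii) The even theorem `largeFieldRarity_even (hCB)`
serves the CLASS-PARAMETRIC infrared leg of the route owner's ruling on the torus-parity junction (ym-beyond-p2 g20, 2026-08-26:
currency `GapInUnitsOnSides G r a 𝓣`, `𝓣_A = familySides`, Bałaban's even sides) once an even indicator chessboard is supplied
(tree `WilsonPlaquetteTail.integral_prod_plaquette_le_rpow_sites` by name + axis permutations + Hölder + `ε ↓ 0`).  (iii) NT's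
(R)/(B4) rows of the desk census name the same supplier.  No implication to `BalabanLadder.IR` is claimed.

HONESTY.  Nothing here proves the Clay Yang–Mills mass gap, a lattice mass gap, `BalabanLadder.IR`, (T) or (M-b); R4 of the
ladder closes only the conditional finite-𝕋⁴ rung `BalabanLadder.UV`.  What IS proved (no `sorry` in this file): the β-uniform
fixed-threshold large-field rarity (R) on odd tori `≥ 3`, for every compact simple `G`.
-/

noncomputable section

open MeasureTheory Finset
open Literature.MathematicalPhysics.QuantumFieldTheory Literature.MathematicalPhysics.QuantumLattice
open Summit.QuantumFields.YangMills.Theorems (OddTorusChessboard.Orient OddTorusChessboard.wilsonExpectation_expObs_le_exp_card_all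
  SoloBlind.expObs)

namespace Summit.QuantumFields.YangMills.Cruxes.IR.LargeFieldRarityChessboard

/-! ## §1 The plaquette cost and the typed statements -/

section Defs

variable {G : Type} [Group G]

/-- The Wilson cost `s_p(U) = N − Re tr ρ(U_p) ∈ [0, 2N]` of one plaquette (string-equal to LINE 3's `plaqCost`). -/
def plaqCost {N L : ℕ} (ρ : G →* Matrix (Fin N) (Fin N) ℂ) (U : GaugeConfig 4 L G)
    (p : Literature.MathematicalPhysics.QuantumFieldTheory.Plaquette 4 L) : ℝ :=
  (N : ℝ) - (ρ (plaquetteHolonomy U p.1 p.2.1.1 p.2.1.2)).trace.re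

/-- **The explicit volume floor** `L₀(β) = (⌈β⌉₊ + 2)²`: every bound below holds on tori of side `L ≥ volFloor β`
(the finite-size error of (FS) is `∝ (1+β)·(L⁴/m + L³m)`, made `O(L⁴)` by `m = ⌈β⌉₊ + 2 ≤ √L`). -/
def volFloor (β : ℝ) : ℕ := (⌈β⌉₊ + 2) * (⌈β⌉₊ + 2)

end Defs

/-- **(FE) FREE-ENERGY INCREMENT** (PROVED: `freeEnergyIncrement_of_thermo freeEnergyThermo finiteSizeFreeEnergy`; Chatterjee-class).  For every compact simple `G` and lattice
representation `r` there are `ν₀, C, β₃ > 0` such that for `β₃ ≤ β' ≤ β` and every torus side `L ≥ volFloor β = (⌈β⌉₊+2)²`:  `log Z_L(β') − log Z_L(β) ≤ ν₀ L⁴ log(β/β') + C L⁴`.  (Gaussian heuristic: `Z(β')/Z(β) = ⟨e^{(β−β')S}⟩_β ≈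
(β/β')^{ν/2}`, `ν = dim G·(3L⁴+1)` transverse modes; the content is the UPPER bound on `Z(β')`, i.e. no log-extensive entropy
beyond the Gaussian one — Chatterjee 2016 Thm 2.1 ∕ §17 for `U(N)` boxes, tree `ChatterjeeJointLimit`.) -/
def FreeEnergyIncrementFrom (fl : ℝ → ℕ) : Prop :=
  ∀ (G : Type) [Group G] [TopologicalSpace G] [IsTopologicalGroup G] [CompactSpace G],
    IsCompactSimpleLieGroup G →
    letI : MeasurableSpace G := borel G
    haveI : BorelSpace G := ⟨rfl⟩
    ∀ (r : LatticeRep G), ∃ (ν₀ C β₃ : ℝ), 0 < β₃ ∧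
      ∀ (L : ℕ) [NeZero L] (β' β : ℝ), β₃ ≤ β' → β' ≤ β → fl β ≤ L →
        torusLogPartition 4 r.ρ β' L - torusLogPartition 4 r.ρ β L ≤
          ν₀ * (L : ℝ) ^ 4 * Real.log (β / β') + C * (L : ℝ) ^ 4

/-- (FE) at the explicit floor `volFloor` (PROVED) — every engine theorem below is stated for a GENERAL floor `fl : ℝ → ℕ`, so
that the floor-free case `fl = 0` (all tori; open below the floor, see `FreeEnergyIncrementBelow`) runs through the same engine. -/
def FreeEnergyIncrement : Prop := FreeEnergyIncrementFrom volFloor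

/-- **(FE∞) FREE-ENERGY ASYMPTOTICS IN THE THERMODYNAMIC LIMIT, bound form** — PROVED below (`freeEnergyThermo`) from the
TREE's kernel-checked Chatterjee theorem for EVERY compact simple `G` and faithful unitary lattice representation:
`Summit.QuantumFields.YangMills.Theorems.freeEnergyLogCoefficient_proof` (crux `FreeEnergyLogCoefficient` of route
`EquipartitionCriticality`, stmt-QuantumFields-8759, closed·proved @ c63cf0bd22ae; axioms `propext, Classical.choice, Quot.sound`
only): `f_r(β) + (3D/2) log β → K_r` (`f_r` = the torus free energy per site `freeEnergyDensity 4 r.ρ`, which exists by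
`exists_hasFreeEnergyDensity_holds`).  Bound form: `|f_r(β) + ν log β − K| ≤ 1` for `β ≥ β₃`. -/
def FreeEnergyThermo : Prop :=
  ∀ (G : Type) [Group G] [TopologicalSpace G] [IsTopologicalGroup G] [CompactSpace G],
    IsCompactSimpleLieGroup G →
    letI : MeasurableSpace G := borel G
    haveI : BorelSpace G := ⟨rfl⟩
    ∀ (r : LatticeRep G), ∃ (ν K β₃ : ℝ), 0 < β₃ ∧
      ∀ β : ℝ, β₃ ≤ β → |freeEnergyDensity 4 r.ρ β + ν * Real.log β - K| ≤ 1

/-- **(FS) FINITE-SIZE BOUND for the torus free energy** (PROVED below: `finiteSizeFreeEnergy`): `|log Z_L(β) − L⁴ f_r(β)| ≤ C(1+|β|)(L⁴/m + L³m)` for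
every `2 ≤ m`, `m² ≤ L`.  Route: the tree's sub-box estimate `FreeEnergy.abs_torusLogPartition_sub_le` (Friedli–Velenik Thm 3.6
pattern: `|log Z_L − ⌊L/m⌋⁴ log Z(A_{m−1})| ≤ |β|(N+M)·6·(L⁴ − ⌊L/m⌋⁴(m−1)⁴)`), once at `(L, m)` and once along `L' → ∞`
(`HasFreeEnergyDensity`, `FreeEnergy.tendsto_div_floor`) to price `|log Z(A_{m−1}) − m⁴ f|`, plus `a⁴ − b⁴ ≤ 4a³(a − b)`. -/
def FiniteSizeFreeEnergy : Prop :=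
  ∀ (G : Type) [Group G] [TopologicalSpace G] [IsTopologicalGroup G] [CompactSpace G],
    letI : MeasurableSpace G := borel G
    haveI : BorelSpace G := ⟨rfl⟩
    ∀ (r : LatticeRep G), ∃ C : ℝ, 0 ≤ C ∧ ∀ (β : ℝ) (L m : ℕ) [NeZero L], 2 ≤ m → m * m ≤ L →
      |torusLogPartition 4 r.ρ β L - (L : ℝ) ^ 4 * freeEnergyDensity 4 r.ρ β| ≤
        C * (1 + |β|) * ((L : ℝ) ^ 4 / m + (L : ℝ) ^ 3 * m)

/-- **(EM) EXPONENTIAL-MOMENT BOUND** for the reduced coupling on an arbitrary plaquette family: there is `λ ∈ (0,1)` with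
`⟨∏_{p∈F} e^{λβ s_p}⟩_{L,β} ≤ e^{C L⁴}` for all `F`, `β ≥ β₃`, `L ≥ L₀(β)` (PROVED from (FE): `expMomentBound_of_increment`). -/
def ExpMomentBoundFrom (fl : ℝ → ℕ) : Prop :=
  ∀ (G : Type) [Group G] [TopologicalSpace G] [IsTopologicalGroup G] [CompactSpace G],
    IsCompactSimpleLieGroup G →
    letI : MeasurableSpace G := borel G
    haveI : BorelSpace G := ⟨rfl⟩
    ∀ (r : LatticeRep G), ∃ (lam C β₃ : ℝ), 0 < lam ∧ 0 < β₃ ∧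
      ∀ (L : ℕ) [NeZero L] (β : ℝ), β₃ ≤ β → fl β ≤ L →
        ∀ F : Finset (Literature.MathematicalPhysics.QuantumFieldTheory.Plaquette 4 L),
          ∫ U, ∏ p ∈ F, Real.exp (lam * β * plaqCost r.ρ U p) ∂(wilsonMeasure (d := 4) (L := L) r.ρ β) ≤
            Real.exp (C * (L : ℝ) ^ 4)

/-- (EM) at the explicit floor (PROVED). -/
def ExpMomentBound : Prop := ExpMomentBoundFrom volFloor

/-- **(CB) CHESSBOARD FOR PLAQUETTE EVENTS, ALL ORIENTATIONS, EVEN SIDES** (plumbing, every ingredient in the tree BY NAME: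
`WilsonPlaquetteTail.integral_prod_plaquette_le_rpow_sites` (FILS Thm 4.1 for the orientations `(0,a)`, applied to `𝟙_E + ε`,
`ε ↓ 0` as in `PlaquetteChessboard.integral_plaquette_le_rpow_all`), `wilsonMeasure_map_configPerm` (axis permutations, for
the orientations `(i,j)`, `0 < i`), and `𝟙_{∩_o} ≤ min_o 𝟙_{∩ Q_o} ≤` geometric mean over the six orientations): for a
measurable conjugation- and inversion-invariant `E ⊆ G`, `μ{∀ p ∈ Q, U_p ∈ E} ≤ ∏_o μ{∀ p of orientation o, U_p ∈ E}^{#Q_o/(6L⁴)}`.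
Holds for every compact `G` (no simplicity) and every `β ≥ 0`; `L` even and non-zero (so `L ≥ 2`). -/
def ChessboardEvents : Prop :=
  ∀ (G : Type) [Group G] [TopologicalSpace G] [IsTopologicalGroup G] [CompactSpace G],
    letI : MeasurableSpace G := borel G
    haveI : BorelSpace G := ⟨rfl⟩
    ∀ (r : LatticeRep G) (L : ℕ) [NeZero L], Even L → ∀ (β : ℝ), 0 ≤ β →
      ∀ (E : Set G), MeasurableSet E → (∀ g h : G, h * g * h⁻¹ ∈ E ↔ g ∈ E) → (∀ g : G, g⁻¹ ∈ E ↔ g ∈ E) →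
        ∀ Q : Finset (Literature.MathematicalPhysics.QuantumFieldTheory.Plaquette 4 L),
          (wilsonMeasure (d := 4) (L := L) r.ρ β).real
              {U | ∀ p ∈ Q, plaquetteHolonomy U p.1 p.2.1.1 p.2.1.2 ∈ E} ≤
            ∏ o : {q : Fin 4 × Fin 4 // q.1 < q.2},
              ((wilsonMeasure (d := 4) (L := L) r.ρ β).real
                  {U | ∀ p : Literature.MathematicalPhysics.QuantumFieldTheory.Plaquette 4 L, p.2 = o →
                    plaquetteHolonomy U p.1 p.2.1.1 p.2.1.2 ∈ E}) ^
                (((Q.filter fun p => p.2 = o).card : ℝ) / (6 * (L : ℝ) ^ 4))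

/-- **(R-even) LARGE-FIELD RARITY ON EVEN TORI, Peierls-multiplicative, uniform in `β` and the volume** (the engine's
output; PROVED from (CB)+(EM): `largeFieldRarityEven_of`).  Compared with LINE 3's `LargeFieldRarity`: even sides with a volume
floor `L ≥ L₀(β)` instead of all odd sides, and `∃ A₀ ∀ A ≥ A₀` with ONE rate `c` instead of `∀ A > 0 ∃ c` (the mechanism
certifies large thresholds only, which is what a Peierls count of SPARSE defects consumes). -/
def LargeFieldRarityEvenFrom (fl : ℝ → ℕ) : Prop :=
  ∀ (G : Type) [Group G] [TopologicalSpace G] [IsTopologicalGroup G] [CompactSpace G],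
    IsCompactSimpleLieGroup G →
    letI : MeasurableSpace G := borel G
    haveI : BorelSpace G := ⟨rfl⟩
    ∀ (r : LatticeRep G), ∃ (c A₀ β₃ : ℝ), 0 < c ∧
      ∀ (A : ℝ), A₀ ≤ A → ∀ (β : ℝ), β₃ ≤ β → ∀ (L : ℕ) [NeZero L], Even L → fl β ≤ L →
        ∀ Q : Finset (Literature.MathematicalPhysics.QuantumFieldTheory.Plaquette 4 L),
          wilsonMeasure (d := 4) (L := L) r.ρ β {U | ∀ p ∈ Q, A / (2 * β) < plaqCost r.ρ U p} ≤
            ENNReal.ofReal (Real.exp (-(c * A * Q.card)))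

/-- (R-even) at the explicit floor. -/
def LargeFieldRarityEven : Prop := LargeFieldRarityEvenFrom volFloor

/-- **(R-odd-literal) = LINE 3's `LargeFieldRarity` VERBATIM** (ALL odd tori `2S+1` incl. `S = 0`, `∀ A > 0 ∃ c`, no volume
floor), recorded for comparison only: NOT proved and NOT implied by `LargeFieldRarityOn {L | Odd L ∧ 3 ≤ L}` (which has
`∃ A₀ ∀ A ≥ A₀` and the floor `L ≥ L₀(β)`). -/
def LargeFieldRarityOdd : Prop :=
  ∀ (G : Type) [Group G] [TopologicalSpace G] [IsTopologicalGroup G] [CompactSpace G],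
    IsCompactSimpleLieGroup G →
    letI : MeasurableSpace G := borel G
    haveI : BorelSpace G := ⟨rfl⟩
    ∀ (r : LatticeRep G) (A : ℝ), 0 < A → ∃ (c β₃ : ℝ), 0 < c ∧ ∀ β : ℝ, β₃ ≤ β →
      ∀ (S : ℕ) (Q : Finset (Literature.MathematicalPhysics.QuantumFieldTheory.Plaquette 4 (2 * S + 1))),
        wilsonMeasure (d := 4) (L := 2 * S + 1) r.ρ β
            {U | ∀ p ∈ Q, A / (2 * β) < plaqCost r.ρ U p} ≤
          ENNReal.ofReal (Real.exp (-(c * A * Q.card)))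


/-- **(CZ) CHESSBOARD-TO-FREE-ENERGY for exponential plaquette functionals, sides in `𝓛`** (PARITY-AGNOSTIC typing of the
reflection-positivity input): there are `k ≥ 1 > kθ > 0` such that for every side `L ∈ 𝓛`, every `β ≥ 0`, every `0 < λ ≤ θ` and
every plaquette set `Q`, `⟨∏_{p∈Q} e^{λβ s_p}⟩_{L,β} ≤ (Z_L((1−kλ)β)/Z_L(β))^{#Q/(kL⁴)}`.  ODD `L ≥ 3`: PROVED below
(`chessboardZRatio_odd`, `k = 6`, `θ = 1/12`) from the tree's `OddTorusChessboard.wilsonExpectation_expObs_le_exp_card_all` (mixed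
site|link reflections of the odd torus, Borgs–Seiler CMP 91 (1983) §II.2; Hölder over the six orientations; FILS Thm 4.1).  EVEN
`L`: the same chain with the tree's `WilsonPlaquetteTail.integral_prod_plaquette_le_rpow_sites` on the positive class function
`e^{6λβ s}` and axis permutations `wilsonMeasure_map_configPerm` — not written here (the even output goes through the indicator
variant `ChessboardEvents` instead). -/
def ChessboardZRatio (𝓛 : Set ℕ) : Prop :=
  ∀ (G : Type) [Group G] [TopologicalSpace G] [IsTopologicalGroup G] [CompactSpace G],
    letI : MeasurableSpace G := borel G
    haveI : BorelSpace G := ⟨rfl⟩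
    ∀ (r : LatticeRep G), ∃ (k θ : ℝ), 0 < θ ∧ 1 ≤ k ∧ k * θ < 1 ∧
      ∀ (L : ℕ) [NeZero L], L ∈ 𝓛 → ∀ (β : ℝ), 0 ≤ β → ∀ (lam : ℝ), 0 < lam → lam ≤ θ →
        ∀ Q : Finset (Literature.MathematicalPhysics.QuantumFieldTheory.Plaquette 4 L),
          ∫ U, ∏ p ∈ Q, Real.exp (lam * β * plaqCost r.ρ U p) ∂(wilsonMeasure (d := 4) (L := L) r.ρ β) ≤
            Real.exp ((torusLogPartition 4 r.ρ ((1 - k * lam) * β) L - torusLogPartition 4 r.ρ β L) *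
              ((Q.card : ℝ) / (k * (L : ℝ) ^ 4)))

/-- **(R-on-𝓛) LARGE-FIELD RARITY ON THE SIDES `𝓛`, Peierls-multiplicative, uniform in `β` and the volume** — the
parity-agnostic output (`LargeFieldRarityEven` is the case `𝓛 = 2ℕ`; PROVED from (CZ)+(FE): `largeFieldRarityOn_of_ZRatio`). -/
def LargeFieldRarityOnFrom (𝓛 : Set ℕ) (fl : ℝ → ℕ) : Prop :=
  ∀ (G : Type) [Group G] [TopologicalSpace G] [IsTopologicalGroup G] [CompactSpace G],
    IsCompactSimpleLieGroup G →
    letI : MeasurableSpace G := borel G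
    haveI : BorelSpace G := ⟨rfl⟩
    ∀ (r : LatticeRep G), ∃ (c A₀ β₃ : ℝ), 0 < c ∧
      ∀ (A : ℝ), A₀ ≤ A → ∀ (β : ℝ), β₃ ≤ β → ∀ (L : ℕ) [NeZero L], L ∈ 𝓛 → fl β ≤ L →
        ∀ Q : Finset (Literature.MathematicalPhysics.QuantumFieldTheory.Plaquette 4 L),
          wilsonMeasure (d := 4) (L := L) r.ρ β {U | ∀ p ∈ Q, A / (2 * β) < plaqCost r.ρ U p} ≤
            ENNReal.ofReal (Real.exp (-(c * A * Q.card)))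

/-- (R-on-𝓛) at the explicit floor (PROVED for `𝓛` = odd sides `≥ 3`). -/
def LargeFieldRarityOn (𝓛 : Set ℕ) : Prop := LargeFieldRarityOnFrom 𝓛 volFloor

/-- **(R-odd-tori) THE MAIN THEOREM AS A NAMED STATEMENT** (PROVED: `largeFieldRarityOddTori_holds`), in the crux's
parametrisation `𝕋⁴_{2S+1}`, `S ≥ 1`: for every compact simple `G` and lattice representation `r` there are `c > 0`, `A₀`, `β₃`
with `μ_{2S+1,β}{∀ p ∈ Q, s_p > A/(2β)} ≤ e^{−cA·#Q}` for all `A ≥ A₀`, `β ≥ β₃`, `2S+1 ≥ volFloor β = (⌈β⌉₊+2)²`, all `Q`. -/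
def LargeFieldRarityOddTori : Prop :=
  ∀ (G : Type) [Group G] [TopologicalSpace G] [IsTopologicalGroup G] [CompactSpace G],
    IsCompactSimpleLieGroup G →
    letI : MeasurableSpace G := borel G
    haveI : BorelSpace G := ⟨rfl⟩
    ∀ (r : LatticeRep G), ∃ (c A₀ β₃ : ℝ), 0 < c ∧
      ∀ A : ℝ, A₀ ≤ A → ∀ β : ℝ, β₃ ≤ β → ∀ S : ℕ, 1 ≤ S → volFloor β ≤ 2 * S + 1 →
        ∀ Q : Finset (Literature.MathematicalPhysics.QuantumFieldTheory.Plaquette 4 (2 * S + 1)),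
          wilsonMeasure (d := 4) (L := 2 * S + 1) r.ρ β {U | ∀ p ∈ Q, A / (2 * β) < plaqCost r.ρ U p} ≤
            ENNReal.ofReal (Real.exp (-(c * A * Q.card)))

/-! ## §2 SEAM 0 (proved): the tree's Chatterjee theorem ⇒ (FE∞); (FE∞) + (FS) ⇒ (FE) -/

/-- **(FE∞) PROVED** from `freeEnergyLogCoefficient_proof` (`ν = 3D/2`, `β₃ = max(N₀, 1)` from the limit). -/
theorem freeEnergyThermo : FreeEnergyThermo := by
  intro G _ _ _ _ hG
  letI : MeasurableSpace G := borel G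
  haveI : BorelSpace G := ⟨rfl⟩
  intro r
  obtain ⟨K, hK⟩ := Summit.QuantumFields.YangMills.Theorems.freeEnergyLogCoefficient_proof G hG r
  obtain ⟨N₀, hN₀⟩ := (Metric.tendsto_atTop.1 hK) 1 one_pos
  refine ⟨3 * (Module.finrank ℝ ↥(Submodule.span ℝ {X : Matrix (Fin r.N) (Fin r.N) ℂ |
      ∀ t : ℝ, NormedSpace.exp ((t : ℂ) • X) ∈ Set.range r.ρ}) : ℝ) / 2, K, max N₀ 1,
    lt_of_lt_of_le one_pos (le_max_right _ _), fun β hβ => ?_⟩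
  have h := hN₀ β (le_trans (le_max_left _ _) hβ)
  rw [Real.dist_eq] at h
  exact h.le

/-- **(FE∞) + (FS) ⇒ (FE)** with `ν₀ = ν`, `C = 2 + 4C_FS`, `m(β) = ⌈β⌉₊ + 2`, floor `L₀(β) = m(β)²`: the two finite-size errors
are `≤ 2C_FS L⁴` each since `(1+β)/m ≤ 1` and `(1+β)m ≤ m² ≤ L`, and `f(β') − f(β) ≤ ν log(β/β') + 2`. -/
theorem freeEnergyIncrement_of_thermo (hT : FreeEnergyThermo) (hS : FiniteSizeFreeEnergy) : FreeEnergyIncrement := by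
  intro G _ _ _ _ hG
  letI : MeasurableSpace G := borel G
  haveI : BorelSpace G := ⟨rfl⟩
  intro r
  obtain ⟨ν, K, β₃, hβ₃, hth⟩ := hT G hG r
  obtain ⟨C, hC0, hfs⟩ := hS G r
  refine ⟨ν, 2 + 4 * C, β₃, hβ₃, ?_⟩
  intro L _ β' β hβ' hβ'β hL
  set m : ℕ := ⌈β⌉₊ + 2 with hm
  have hm2 : 2 ≤ m := by omega
  have hmL : m * m ≤ L := hL
  have hβ'pos : 0 < β' := lt_of_lt_of_le hβ₃ hβ'
  have hβpos : 0 < β := lt_of_lt_of_le hβ'pos hβ'β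
  have h1 := hth β' hβ'
  have h2 := hth β (hβ'.trans hβ'β)
  have e1 := hfs β' L m hm2 hmL
  have e2 := hfs β L m hm2 hmL
  have hmβ : β + 1 ≤ (m : ℝ) := by
    have := Nat.le_ceil β
    rw [hm]; push_cast; linarith
  have hmR : (0 : ℝ) < m := by positivity
  have hLR : (m : ℝ) * m ≤ L := by exact_mod_cast hmL
  have hL4 : (0 : ℝ) ≤ (L : ℝ) ^ 4 := by positivity
  have key : ∀ b : ℝ, 0 ≤ b → b ≤ β → (1 + |b|) * ((L : ℝ) ^ 4 / m + (L : ℝ) ^ 3 * m) ≤ 2 * (L : ℝ) ^ 4 := by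
    intro b hb0 hb
    rw [abs_of_nonneg hb0]
    have hb1 : 1 + b ≤ m := by linarith
    have t1 : (1 + b) * ((L : ℝ) ^ 4 / m) ≤ (L : ℝ) ^ 4 :=
      calc (1 + b) * ((L : ℝ) ^ 4 / m) = (1 + b) * (L : ℝ) ^ 4 / m := by ring
        _ ≤ (m : ℝ) * (L : ℝ) ^ 4 / m := by gcongr
        _ = (L : ℝ) ^ 4 := mul_div_cancel_left₀ _ hmR.ne'
    have t2 : (1 + b) * ((L : ℝ) ^ 3 * m) ≤ (L : ℝ) ^ 4 := by
      have h : (1 + b) * (m : ℝ) ≤ L := le_trans (mul_le_mul_of_nonneg_right hb1 hmR.le) hLR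
      calc (1 + b) * ((L : ℝ) ^ 3 * m) = ((1 + b) * m) * (L : ℝ) ^ 3 := by ring
        _ ≤ (L : ℝ) * (L : ℝ) ^ 3 := mul_le_mul_of_nonneg_right h (by positivity)
        _ = (L : ℝ) ^ 4 := by ring
    calc (1 + b) * ((L : ℝ) ^ 4 / m + (L : ℝ) ^ 3 * m)
        = (1 + b) * ((L : ℝ) ^ 4 / m) + (1 + b) * ((L : ℝ) ^ 3 * m) := by ring
      _ ≤ (L : ℝ) ^ 4 + (L : ℝ) ^ 4 := add_le_add t1 t2
      _ = 2 * (L : ℝ) ^ 4 := by ring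
  have E1 : |torusLogPartition 4 r.ρ β' L - (L : ℝ) ^ 4 * freeEnergyDensity 4 r.ρ β'| ≤ C * (2 * (L : ℝ) ^ 4) := by
    refine e1.trans ?_
    rw [mul_assoc]
    exact mul_le_mul_of_nonneg_left (key β' hβ'pos.le hβ'β) hC0
  have E2 : |torusLogPartition 4 r.ρ β L - (L : ℝ) ^ 4 * freeEnergyDensity 4 r.ρ β| ≤ C * (2 * (L : ℝ) ^ 4) := by
    refine e2.trans ?_
    rw [mul_assoc]
    exact mul_le_mul_of_nonneg_left (key β hβpos.le le_rfl) hC0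
  rw [abs_le] at h1 h2 E1 E2
  rw [Real.log_div hβpos.ne' hβ'pos.ne']
  have hf : (L : ℝ) ^ 4 * (freeEnergyDensity 4 r.ρ β' - freeEnergyDensity 4 r.ρ β) ≤
      (L : ℝ) ^ 4 * (ν * (Real.log β - Real.log β') + 2) :=
    mul_le_mul_of_nonneg_left (by linarith [h1.2, h2.1]) hL4
  linarith [hf, E1.2, E2.1]

/-! ## §2b (proved): (FS) from the tree's sub-box estimate and the existence of the density -/

section FiniteSize

open Filter Topology

/-- `a⁴ − b⁴ ≤ 4a³(a − b)` for `0 ≤ b ≤ a`. -/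
theorem pow_four_sub_pow_four_le {a b : ℝ} (hb : 0 ≤ b) (hab : b ≤ a) :
    a ^ 4 - b ^ 4 ≤ 4 * a ^ 3 * (a - b) := by
  have ha : 0 ≤ a := hb.trans hab
  nlinarith [mul_nonneg hb ha, mul_nonneg (mul_nonneg hb hb) ha, mul_nonneg (mul_nonneg hb hb) (mul_nonneg hb ha),
    pow_le_pow_left₀ hb hab 2, pow_le_pow_left₀ hb hab 3, mul_nonneg (sub_nonneg.2 hab) (mul_nonneg ha ha)]

/-- **Abstract finite-size lemma.**  If a sequence `ψ` satisfies the sub-box estimate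
`|ψ L − ⌊L/m⌋⁴ c| ≤ K (L⁴ − ⌊L/m⌋⁴ (m−1)⁴)` at every level, `ψ(L)/L⁴ → f`, and `|c| ≤ K (m−1)⁴`, then
`|ψ L − L⁴ f| ≤ 8K (L⁴/m + L³ m)`. -/
theorem abs_sub_limit_le_of_subbox {ψ : ℕ → ℝ} {f K c : ℝ} {m : ℕ} (hm : 1 ≤ m) (hK : 0 ≤ K)
    (H1 : ∀ L : ℕ, 1 ≤ L → |ψ L - (((L / m) ^ 4 : ℕ) : ℝ) * c| ≤
      K * ((L : ℝ) ^ 4 - (((L / m) ^ 4 : ℕ) : ℝ) * (((m - 1 : ℕ) : ℝ)) ^ 4))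
    (H2 : Tendsto (fun L : ℕ => (((L + 1 : ℕ) : ℝ) ^ 4)⁻¹ * ψ (L + 1)) atTop (𝓝 f))
    (Hc : |c| ≤ K * (((m - 1 : ℕ) : ℝ)) ^ 4) (L : ℕ) (hL : 1 ≤ L) :
    |ψ L - (L : ℝ) ^ 4 * f| ≤ 8 * K * ((L : ℝ) ^ 4 / m + (L : ℝ) ^ 3 * m) := by
  have hmR : (0 : ℝ) < m := by exact_mod_cast hm
  have hm1R : (((m - 1 : ℕ) : ℝ)) = (m : ℝ) - 1 := by rw [Nat.cast_sub hm, Nat.cast_one]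
  have hm1nn : (0 : ℝ) ≤ (m : ℝ) - 1 := by linarith [show (1 : ℝ) ≤ m by exact_mod_cast hm]
  -- Step (a): the limit argument, `|m⁴ f − c| ≤ K (m⁴ − (m−1)⁴)`
  have hb : Tendsto (fun L : ℕ => (((L + 1) / m : ℕ) : ℝ) / ((L + 1 : ℕ) : ℝ)) atTop (𝓝 (1 / m)) :=
    FreeEnergy.tendsto_div_floor m
  set g : ℕ → ℝ := fun L => (((L + 1 : ℕ) : ℝ) ^ 4)⁻¹ * ψ (L + 1) -
    ((((L + 1) / m : ℕ) : ℝ) / ((L + 1 : ℕ) : ℝ)) ^ 4 * c with hg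
  set h : ℕ → ℝ := fun L => K * (1 - ((((L + 1) / m : ℕ) : ℝ) / ((L + 1 : ℕ) : ℝ)) ^ 4 * ((m : ℝ) - 1) ^ 4) with hh
  have hg_t : Tendsto g atTop (𝓝 (f - (1 / m) ^ 4 * c)) := H2.sub ((hb.pow 4).mul_const c)
  have hh_t : Tendsto h atTop (𝓝 (K * (1 - (1 / (m : ℝ)) ^ 4 * ((m : ℝ) - 1) ^ 4))) :=
    (tendsto_const_nhds.sub ((hb.pow 4).mul_const _)).const_mul K
  have hgh : ∀ L : ℕ, |g L| ≤ h L := by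
    intro L
    have hn : (0 : ℝ) < ((L + 1 : ℕ) : ℝ) := by positivity
    have hn4 : (0 : ℝ) < ((L + 1 : ℕ) : ℝ) ^ 4 := by positivity
    have e := H1 (L + 1) (by omega)
    rw [hm1R] at e
    have hq : ((((L + 1) / m) ^ 4 : ℕ) : ℝ) = ((((L + 1) / m : ℕ) : ℝ)) ^ 4 := by push_cast; ring
    rw [hq] at e
    -- divide by n⁴
    have e' : |(ψ (L + 1) - ((((L + 1) / m : ℕ) : ℝ)) ^ 4 * c) / ((L + 1 : ℕ) : ℝ) ^ 4| ≤
        K * ((((L + 1 : ℕ) : ℝ)) ^ 4 - ((((L + 1) / m : ℕ) : ℝ)) ^ 4 * ((m : ℝ) - 1) ^ 4) / ((L + 1 : ℕ) : ℝ) ^ 4 := by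
      rw [abs_div, abs_of_pos hn4]
      exact div_le_div_of_nonneg_right e hn4.le
    have eg : g L = (ψ (L + 1) - ((((L + 1) / m : ℕ) : ℝ)) ^ 4 * c) / ((L + 1 : ℕ) : ℝ) ^ 4 := by
      rw [hg]; field_simp
    have eh : h L = K * ((((L + 1 : ℕ) : ℝ)) ^ 4 - ((((L + 1) / m : ℕ) : ℝ)) ^ 4 * ((m : ℝ) - 1) ^ 4) /
        ((L + 1 : ℕ) : ℝ) ^ 4 := by
      rw [hh]; field_simp
    rw [eg, eh]; exact e'
  have hlim : |f - (1 / (m : ℝ)) ^ 4 * c| ≤ K * (1 - (1 / (m : ℝ)) ^ 4 * ((m : ℝ) - 1) ^ 4) :=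
    le_of_tendsto_of_tendsto' hg_t.abs hh_t hgh
  have ha : |(m : ℝ) ^ 4 * f - c| ≤ K * ((m : ℝ) ^ 4 - ((m : ℝ) - 1) ^ 4) := by
    have hm4 : (0 : ℝ) < (m : ℝ) ^ 4 := by positivity
    have e1 : (m : ℝ) ^ 4 * f - c = (m : ℝ) ^ 4 * (f - (1 / (m : ℝ)) ^ 4 * c) := by field_simp
    have e2 : K * ((m : ℝ) ^ 4 - ((m : ℝ) - 1) ^ 4) = (m : ℝ) ^ 4 * (K * (1 - (1 / (m : ℝ)) ^ 4 * ((m : ℝ) - 1) ^ 4)) := by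
      field_simp
    rw [e1, e2, abs_mul, abs_of_pos hm4]
    exact mul_le_mul_of_nonneg_left hlim hm4.le
  -- |f| ≤ K
  have hf : |f| ≤ K := by
    have hm4 : (0 : ℝ) < (m : ℝ) ^ 4 := by positivity
    rw [hm1R] at Hc
    have h1 : |(m : ℝ) ^ 4 * f| ≤ K * (m : ℝ) ^ 4 := by
      calc |(m : ℝ) ^ 4 * f| = |((m : ℝ) ^ 4 * f - c) + c| := by ring_nf
        _ ≤ |(m : ℝ) ^ 4 * f - c| + |c| := abs_add_le _ _
        _ ≤ K * ((m : ℝ) ^ 4 - ((m : ℝ) - 1) ^ 4) + K * ((m : ℝ) - 1) ^ 4 := add_le_add ha Hc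
        _ = K * (m : ℝ) ^ 4 := by ring
    rw [abs_mul, abs_of_pos hm4] at h1
    nlinarith
  -- Step (b): the three terms at level L
  have e := H1 L hL
  rw [hm1R] at e
  set q : ℝ := ((L / m : ℕ) : ℝ) with hqdef
  have hq4 : (((L / m) ^ 4 : ℕ) : ℝ) = q ^ 4 := by rw [hqdef]; push_cast; ring
  rw [hq4] at e
  have hq0 : 0 ≤ q := by positivity
  have hqm : q * m ≤ L := by
    rw [hqdef]; exact_mod_cast Nat.div_mul_le_self L m
  have hLq : (L : ℝ) - m ≤ q * m := by
    have := Nat.lt_div_mul_add (a := L) (b := m) (by omega)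
    rw [hqdef]
    have h' : (L : ℝ) < ((L / m : ℕ) : ℝ) * m + m := by exact_mod_cast this
    linarith
  have hqL : q ≤ (L : ℝ) / m := by rw [le_div_iff₀ hmR]; exact hqm
  have hL0 : (0 : ℝ) ≤ L := by positivity
  have hL3 : (0 : ℝ) ≤ (L : ℝ) ^ 3 := by positivity
  -- T3: L⁴ − (qm)⁴ ≤ 4 L³ m
  have T3 : (L : ℝ) ^ 4 - (q * m) ^ 4 ≤ 4 * (L : ℝ) ^ 3 * m := by
    have h1 := pow_four_sub_pow_four_le (by positivity : (0 : ℝ) ≤ q * m) hqm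
    have h2 : 4 * (L : ℝ) ^ 3 * ((L : ℝ) - q * m) ≤ 4 * (L : ℝ) ^ 3 * m :=
      mul_le_mul_of_nonneg_left (by linarith) (by positivity)
    linarith
  -- T1: L⁴ − (q(m−1))⁴ ≤ 4 L³ m + 4 L⁴/m
  have T1 : (L : ℝ) ^ 4 - (q * ((m : ℝ) - 1)) ^ 4 ≤ 4 * (L : ℝ) ^ 3 * m + 4 * (L : ℝ) ^ 4 / m := by
    have hP0 : 0 ≤ q * ((m : ℝ) - 1) := mul_nonneg hq0 hm1nn
    have hPL : q * ((m : ℝ) - 1) ≤ L := by nlinarith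
    have h1 := pow_four_sub_pow_four_le hP0 hPL
    have h2 : (L : ℝ) - q * ((m : ℝ) - 1) ≤ m + (L : ℝ) / m := by nlinarith
    have h3 : 4 * (L : ℝ) ^ 3 * ((L : ℝ) - q * ((m : ℝ) - 1)) ≤ 4 * (L : ℝ) ^ 3 * (m + (L : ℝ) / m) :=
      mul_le_mul_of_nonneg_left h2 (by positivity)
    have h4 : 4 * (L : ℝ) ^ 3 * (m + (L : ℝ) / m) = 4 * (L : ℝ) ^ 3 * m + 4 * (L : ℝ) ^ 4 / m := by ring
    linarith
  -- T2: q⁴ (m⁴ − (m−1)⁴) ≤ 4 L⁴ / m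
  have T2 : q ^ 4 * ((m : ℝ) ^ 4 - ((m : ℝ) - 1) ^ 4) ≤ 4 * (L : ℝ) ^ 4 / m := by
    have h1 := pow_four_sub_pow_four_le hm1nn (by linarith : (m : ℝ) - 1 ≤ m)
    have h1' : (m : ℝ) ^ 4 - ((m : ℝ) - 1) ^ 4 ≤ 4 * (m : ℝ) ^ 3 := by nlinarith
    have h2 : q ^ 4 * ((m : ℝ) ^ 4 - ((m : ℝ) - 1) ^ 4) ≤ q ^ 4 * (4 * (m : ℝ) ^ 3) :=
      mul_le_mul_of_nonneg_left h1' (by positivity)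
    have h3 : q ^ 4 * (4 * (m : ℝ) ^ 3) = 4 * (q * m) ^ 4 / m := by field_simp
    have h4 : (q * m) ^ 4 ≤ (L : ℝ) ^ 4 := pow_le_pow_left₀ (by positivity) hqm 4
    have h5 : 4 * (q * m) ^ 4 / m ≤ 4 * (L : ℝ) ^ 4 / m := by gcongr
    linarith
  -- the three pieces
  have A1 : |ψ L - q ^ 4 * c| ≤ K * (4 * (L : ℝ) ^ 3 * m + 4 * (L : ℝ) ^ 4 / m) := by
    refine e.trans (mul_le_mul_of_nonneg_left ?_ hK)
    have : q ^ 4 * ((m : ℝ) - 1) ^ 4 = (q * ((m : ℝ) - 1)) ^ 4 := by ring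
    rw [this]; exact T1
  have A2 : |q ^ 4 * c - q ^ 4 * ((m : ℝ) ^ 4 * f)| ≤ K * (4 * (L : ℝ) ^ 4 / m) := by
    rw [← mul_sub, abs_mul, abs_of_nonneg (by positivity : (0 : ℝ) ≤ q ^ 4), abs_sub_comm]
    calc q ^ 4 * |(m : ℝ) ^ 4 * f - c| ≤ q ^ 4 * (K * ((m : ℝ) ^ 4 - ((m : ℝ) - 1) ^ 4)) :=
          mul_le_mul_of_nonneg_left ha (by positivity)
      _ = K * (q ^ 4 * ((m : ℝ) ^ 4 - ((m : ℝ) - 1) ^ 4)) := by ring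
      _ ≤ K * (4 * (L : ℝ) ^ 4 / m) := mul_le_mul_of_nonneg_left T2 hK
  have A3 : |q ^ 4 * ((m : ℝ) ^ 4 * f) - (L : ℝ) ^ 4 * f| ≤ K * (4 * (L : ℝ) ^ 3 * m) := by
    have h4 : (q * m) ^ 4 ≤ (L : ℝ) ^ 4 := pow_le_pow_left₀ (by positivity) hqm 4
    have : q ^ 4 * ((m : ℝ) ^ 4 * f) - (L : ℝ) ^ 4 * f = -(((L : ℝ) ^ 4 - (q * m) ^ 4) * f) := by ring
    rw [this, abs_neg, abs_mul, abs_of_nonneg (by linarith : (0 : ℝ) ≤ (L : ℝ) ^ 4 - (q * m) ^ 4)]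
    calc ((L : ℝ) ^ 4 - (q * m) ^ 4) * |f| ≤ (4 * (L : ℝ) ^ 3 * m) * K :=
          mul_le_mul T3 hf (abs_nonneg _) (by positivity)
      _ = K * (4 * (L : ℝ) ^ 3 * m) := by ring
  calc |ψ L - (L : ℝ) ^ 4 * f|
      ≤ |ψ L - q ^ 4 * c| + |q ^ 4 * c - (L : ℝ) ^ 4 * f| := abs_sub_le _ _ _
    _ ≤ |ψ L - q ^ 4 * c| + (|q ^ 4 * c - q ^ 4 * ((m : ℝ) ^ 4 * f)| +
          |q ^ 4 * ((m : ℝ) ^ 4 * f) - (L : ℝ) ^ 4 * f|) := by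
        gcongr; exact abs_sub_le _ _ _
    _ ≤ K * (4 * (L : ℝ) ^ 3 * m + 4 * (L : ℝ) ^ 4 / m) + (K * (4 * (L : ℝ) ^ 4 / m) + K * (4 * (L : ℝ) ^ 3 * m)) :=
        add_le_add A1 (add_le_add A2 A3)
    _ = 8 * K * ((L : ℝ) ^ 4 / m + (L : ℝ) ^ 3 * m) := by ring

variable {G : Type} [Group G] [TopologicalSpace G] [IsTopologicalGroup G] [CompactSpace G]
  [MeasurableSpace G] [BorelSpace G]

/-- **(FS) for one lattice representation, all `β`, all `m ≥ 1`**: the sub-box estimate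
`FreeEnergy.abs_torusLogPartition_sub_le`, the box bounds `FreeEnergy.zdZ_le` / `pow_le_zdZ` (for `|log Z(A_{m−1})|`), the
existence of the density `exists_hasFreeEnergyDensity_holds`, and the abstract lemma. -/
theorem abs_torusLogPartition_sub_density_le (r : LatticeRep G) :
    ∃ C : ℝ, 0 ≤ C ∧ ∀ (β : ℝ) (L m : ℕ) [NeZero L], 1 ≤ m →
      |torusLogPartition 4 r.ρ β L - (L : ℝ) ^ 4 * freeEnergyDensity 4 r.ρ β| ≤
        C * |β| * ((L : ℝ) ^ 4 / m + (L : ℝ) ^ 3 * m) := by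
  classical
  haveI : SecondCountableTopology G :=
    (r.continuous.isClosedEmbedding r.injective).isEmbedding.secondCountableTopology
  obtain ⟨M, hM0, hM⟩ := exists_bound_trace_re_nonneg r.ρ r.continuous
  set P : ℕ := Fintype.card {q : Fin 4 × Fin 4 // q.1 < q.2} with hP
  refine ⟨8 * (((r.N : ℝ) + M) * P), by positivity, ?_⟩
  intro β L m _ hm
  set K : ℝ := |β| * ((r.N : ℝ) + M) * P with hK
  have hK0 : 0 ≤ K := by positivity
  -- the density
  obtain ⟨f, hfd⟩ := exists_hasFreeEnergyDensity_holds (d := 4) r.ρ r.continuous β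
  have hfeq : freeEnergyDensity 4 r.ρ β = f := hfd.freeEnergyDensity_eq
  rw [hfeq]
  -- the box constant and its a-priori bound
  have hsub := fun (L' : ℕ) (hL' : 1 ≤ L') =>
    @FreeEnergy.abs_torusLogPartition_sub_le 4 r.N G _ _ _ _ _ _ r.ρ _ r.continuous M hM β L' m ⟨by omega⟩ hm
  set Zb : ℝ := ∫ U, ∏ p ∈ (Literature.Probability.LatticeModels.halfOpenBox 4 (m - 1) ×ˢ Finset.univ :
      Finset (ZdPlaquette 4)), Real.exp (-β * ((r.N : ℝ) - plaquetteObs r.ρ p.1 p.2.1.1 p.2.1.2 U))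
      ∂zdHaar 4 G with hZb
  have hcard : ((Literature.Probability.LatticeModels.halfOpenBox 4 (m - 1) ×ˢ Finset.univ :
      Finset (ZdPlaquette 4))).card = (m - 1) ^ 4 * P := by
    rw [Finset.card_product, Literature.Probability.LatticeModels.card_halfOpenBox, Finset.card_univ]
  have hZup := FreeEnergy.zdZ_le (d := 4) r.ρ r.continuous hM β
    (Literature.Probability.LatticeModels.halfOpenBox 4 (m - 1) ×ˢ Finset.univ)
  have hZlo := FreeEnergy.pow_le_zdZ (d := 4) r.ρ r.continuous hM β
    (Literature.Probability.LatticeModels.halfOpenBox 4 (m - 1) ×ˢ Finset.univ)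
  rw [hcard] at hZup hZlo
  have hZpos : 0 < Zb := lt_of_lt_of_le (pow_pos (Real.exp_pos _) _) hZlo
  have Hc : |Real.log Zb| ≤ K * (((m - 1 : ℕ) : ℝ)) ^ 4 := by
    rw [abs_le]
    constructor
    · have h := Real.log_le_log (pow_pos (Real.exp_pos _) _) hZlo
      rw [Real.log_pow, Real.log_exp] at h
      have : ((((m - 1) ^ 4 * P : ℕ)) : ℝ) * -(|β| * ((r.N : ℝ) + M)) = -(K * (((m - 1 : ℕ) : ℝ)) ^ 4) := by
        rw [hK]; push_cast; ring
      linarith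
    · have h := Real.log_le_log hZpos hZup
      rw [Real.log_pow, Real.log_exp] at h
      have : ((((m - 1) ^ 4 * P : ℕ)) : ℝ) * (|β| * ((r.N : ℝ) + M)) = K * (((m - 1 : ℕ) : ℝ)) ^ 4 := by
        rw [hK]; push_cast; ring
      linarith
  -- the sequence (extended by `0` at `L' = 0`, where the torus is not defined)
  let ψ : ℕ → ℝ := fun L' => if h : L' = 0 then 0 else
    (haveI : NeZero L' := ⟨h⟩; torusLogPartition 4 r.ρ β L')
  have hψ : ∀ (L' : ℕ) [NeZero L'], ψ L' = torusLogPartition 4 r.ρ β L' := fun L' _ =>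
    dif_neg (NeZero.ne L')
  have H1 : ∀ L' : ℕ, 1 ≤ L' → |ψ L' - (((L' / m) ^ 4 : ℕ) : ℝ) * Real.log Zb| ≤
      K * ((L' : ℝ) ^ 4 - (((L' / m) ^ 4 : ℕ) : ℝ) * (((m - 1 : ℕ) : ℝ)) ^ 4) := by
    intro L' hL'
    haveI : NeZero L' := ⟨by omega⟩
    rw [hψ L']
    have h := hsub L' hL'
    have e : |β| * ((r.N : ℝ) + M) * ((P : ℝ) * ((L' : ℝ) ^ 4 - (((L' / m) ^ 4 : ℕ) : ℝ) * (((m - 1 : ℕ) : ℝ)) ^ 4)) =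
        K * ((L' : ℝ) ^ 4 - (((L' / m) ^ 4 : ℕ) : ℝ) * (((m - 1 : ℕ) : ℝ)) ^ 4) := by rw [hK]; ring
    rw [← e, hP]
    exact h
  have H2 : Tendsto (fun L' : ℕ => (((L' + 1 : ℕ) : ℝ) ^ 4)⁻¹ * ψ (L' + 1)) atTop (𝓝 f) := by
    have : (fun L' : ℕ => (((L' + 1 : ℕ) : ℝ) ^ 4)⁻¹ * ψ (L' + 1)) =
        fun L' : ℕ => (((L' + 1 : ℕ) : ℝ) ^ 4)⁻¹ * torusLogPartition 4 r.ρ β (L' + 1) :=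
      funext fun L' => by rw [hψ (L' + 1)]
    rw [this]; exact hfd
  have main := abs_sub_limit_le_of_subbox hm hK0 H1 H2 Hc L (Nat.one_le_iff_ne_zero.2 (NeZero.ne L))
  rw [hψ L] at main
  have e : 8 * K * ((L : ℝ) ^ 4 / m + (L : ℝ) ^ 3 * m) = 8 * (((r.N : ℝ) + M) * P) * |β| * ((L : ℝ) ^ 4 / m + (L : ℝ) ^ 3 * m) := by
    rw [hK]; ring
  rw [← e]; exact main

/-- **(FS) PROVED.** -/
theorem finiteSizeFreeEnergy : FiniteSizeFreeEnergy := by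
  intro G _ _ _ _
  letI : MeasurableSpace G := borel G
  haveI : BorelSpace G := ⟨rfl⟩
  intro r
  obtain ⟨C, hC0, h⟩ := abs_torusLogPartition_sub_density_le r
  refine ⟨C, hC0, fun β L m _ hm _ => ?_⟩
  refine (h β L m (by omega)).trans ?_
  have hx : 0 ≤ (L : ℝ) ^ 4 / m + (L : ℝ) ^ 3 * m := by positivity
  have : C * |β| ≤ C * (1 + |β|) := mul_le_mul_of_nonneg_left (by linarith [abs_nonneg β]) hC0
  exact mul_le_mul_of_nonneg_right this hx

end FiniteSize

/-! ## §3 Elementary facts about the plaquette cost -/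

section Cost

variable {G : Type} [Group G] [TopologicalSpace G] [IsTopologicalGroup G] [CompactSpace G]
  [MeasurableSpace G] [BorelSpace G]

omit [MeasurableSpace G] [BorelSpace G] in
/-- `0 ≤ s_p` (unitary-trick bound `|Re tr ρ| ≤ N`). -/
theorem plaqCost_nonneg (r : LatticeRep G) {L : ℕ} (U : GaugeConfig 4 L G)
    (p : Literature.MathematicalPhysics.QuantumFieldTheory.Plaquette 4 L) : 0 ≤ plaqCost r.ρ U p := by
  unfold plaqCost
  have h := Literature.RepresentationTheory.CompactGroups.CompactGroup.abs_re_trace_le_card r.ρ r.continuous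
    (plaquetteHolonomy U p.1 p.2.1.1 p.2.1.2)
  rw [Fintype.card_fin] at h
  linarith [(abs_le.1 h).2]

omit [MeasurableSpace G] [BorelSpace G] in
/-- `s_p ≤ 2N`. -/
theorem plaqCost_le (r : LatticeRep G) {L : ℕ} (U : GaugeConfig 4 L G)
    (p : Literature.MathematicalPhysics.QuantumFieldTheory.Plaquette 4 L) : plaqCost r.ρ U p ≤ 2 * r.N := by
  unfold plaqCost
  have h := Literature.RepresentationTheory.CompactGroups.CompactGroup.abs_re_trace_le_card r.ρ r.continuous
    (plaquetteHolonomy U p.1 p.2.1.1 p.2.1.2)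
  rw [Fintype.card_fin] at h
  linarith [(abs_le.1 h).1]

omit [MeasurableSpace G] [BorelSpace G] in
/-- `Σ_{p ∈ F} s_p ≤ S(U)` (all costs are non-negative). -/
theorem sum_plaqCost_le_wilsonAction (r : LatticeRep G) {L : ℕ} [NeZero L] (U : GaugeConfig 4 L G)
    (F : Finset (Literature.MathematicalPhysics.QuantumFieldTheory.Plaquette 4 L)) :
    ∑ p ∈ F, plaqCost r.ρ U p ≤ wilsonAction r.ρ U := by
  unfold wilsonAction
  calc ∑ p ∈ F, plaqCost r.ρ U p ≤ ∑ p, plaqCost r.ρ U p :=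
        Finset.sum_le_univ_sum_of_nonneg fun p => plaqCost_nonneg r U p
    _ = _ := rfl

/-- Measurability of `U ↦ s_p(U)` (second countability of `G` from the faithful representation). -/
theorem measurable_plaqCost (r : LatticeRep G) {L : ℕ}
    (p : Literature.MathematicalPhysics.QuantumFieldTheory.Plaquette 4 L) :
    Measurable fun U : GaugeConfig 4 L G => plaqCost r.ρ U p := by
  haveI : SecondCountableTopology G :=
    (r.continuous.isClosedEmbedding r.injective).isEmbedding.secondCountableTopology
  have hcont : Continuous fun g : G => ((r.ρ g).trace).re :=
    Complex.continuous_re.comp r.continuous.matrix_trace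
  unfold plaqCost
  exact measurable_const.sub (hcont.measurable.comp (measurable_plaquetteHolonomy _ _ _))

omit [TopologicalSpace G] [IsTopologicalGroup G] [CompactSpace G] [MeasurableSpace G] in
/-- `plaqCost` is the Literature's `plaquetteCost` (and LINE 3's `plaqCost`, and `SoloBlind.plaquetteCost`) — all `rfl`. -/
theorem plaqCost_eq_plaquetteCost {N L : ℕ} (ρ : G →* Matrix (Fin N) (Fin N) ℂ) (U : GaugeConfig 4 L G)
    (p : Literature.MathematicalPhysics.QuantumFieldTheory.Plaquette 4 L) :
    plaqCost ρ U p = plaquetteCost ρ U p := rfl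

end Cost

/-! ## §4 SEAM 1 (proved): (FE) ⇒ (EM) -/

/-- **(FE) ⇒ (EM)** with `λ = 1/2`: `∏_{p∈F} e^{β s_p/2} ≤ e^{β S/2}` pointwise, `⟨e^{βS/2}⟩_β = Z(β/2)/Z(β)`, and the
free-energy increment at `β' = β/2`. -/
theorem expMomentBound_of_increment {fl : ℝ → ℕ} (hFE : FreeEnergyIncrementFrom fl) : ExpMomentBoundFrom fl := by
  intro G _ _ _ _ hG
  letI : MeasurableSpace G := borel G
  haveI : BorelSpace G := ⟨rfl⟩
  intro r
  obtain ⟨ν₀, C, β₃, hβ₃, hinc⟩ := hFE G hG r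
  refine ⟨1 / 2, ν₀ * Real.log 2 + C, 2 * β₃, by norm_num, by linarith, ?_⟩
  intro L _ β hβ hL F
  haveI := isProbabilityMeasure_wilsonMeasure (d := 4) (L := L) (G := G) r.ρ r.continuous β
  have hβpos : 0 < β := by linarith
  -- the product Haar measure and the Boltzmann integrals
  set π₀ : Measure (GaugeConfig 4 L G) :=
    Measure.pi fun _ : Literature.MathematicalPhysics.QuantumFieldTheory.Edge 4 L => haarProbability G with hπ₀
  set Z : ℝ → ℝ := fun b => ∫ U, Real.exp (-b * wilsonAction r.ρ U) ∂π₀ with hZ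
  have hZpos : ∀ b, 0 < Z b := fun b => integral_exp_neg_mul_wilsonAction_pos r.ρ r.continuous b
  -- Step 1: pointwise domination by `exp(β S / 2)`
  have hdom : ∀ U : GaugeConfig 4 L G,
      ∏ p ∈ F, Real.exp (1 / 2 * β * plaqCost r.ρ U p) ≤ Real.exp ((β - β / 2) * wilsonAction r.ρ U) := by
    intro U
    rw [← Real.exp_sum]
    refine Real.exp_le_exp.2 ?_
    rw [← Finset.mul_sum]
    have hs := sum_plaqCost_le_wilsonAction r U F
    have : (β - β / 2) = 1 / 2 * β := by ring
    rw [this]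
    exact mul_le_mul_of_nonneg_left hs (by positivity)
  have hnn : 0 ≤ᵐ[wilsonMeasure (d := 4) (L := L) r.ρ β]
      fun U => ∏ p ∈ F, Real.exp (1 / 2 * β * plaqCost r.ρ U p) :=
    ae_of_all _ fun U => Finset.prod_nonneg fun p _ => (Real.exp_pos _).le
  have hint : Integrable (fun U => Real.exp ((β - β / 2) * wilsonAction r.ρ U))
      (wilsonMeasure (d := 4) (L := L) r.ρ β) :=
    integrable_exp_mul_wilsonAction r.ρ r.continuous _ _
  have h1 : ∫ U, ∏ p ∈ F, Real.exp (1 / 2 * β * plaqCost r.ρ U p) ∂(wilsonMeasure (d := 4) (L := L) r.ρ β) ≤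
      ∫ U, Real.exp ((β - β / 2) * wilsonAction r.ρ U) ∂(wilsonMeasure (d := 4) (L := L) r.ρ β) :=
    integral_mono_of_nonneg hnn hint (ae_of_all _ hdom)
  -- Step 2: the Gibbs identity `⟨e^{(β-β')S}⟩_β = Z(β')/Z(β)` with `β' = β/2`
  have hR : ∫ U, Real.exp ((β - β / 2) * wilsonAction r.ρ U) ∂(wilsonMeasure (d := 4) (L := L) r.ρ β) =
      Z (β / 2) / Z β := by
    have h := wilsonExpectation_eq_integral_div (d := 4) (L := L) r.ρ r.continuous β
      (fun U => Real.exp ((β - β / 2) * wilsonAction r.ρ U))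
    unfold wilsonExpectation at h
    rw [h]
    congr 1
    refine integral_congr_ae (ae_of_all _ fun U => ?_)
    beta_reduce
    rw [← Real.exp_add]
    congr 1
    ring
  -- Step 3: the increment bound
  have hψ : Real.log (Z (β / 2)) - Real.log (Z β) ≤ ν₀ * (L : ℝ) ^ 4 * Real.log 2 + C * (L : ℝ) ^ 4 := by
    have h := hinc L (β / 2) β (by linarith) (by linarith) hL
    rw [torusLogPartition_eq_log_integral r.ρ r.continuous, torusLogPartition_eq_log_integral r.ρ r.continuous] at h
    have hdiv : β / (β / 2) = 2 := by field_simp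
    rw [hdiv] at h
    exact h
  have h2 : Z (β / 2) / Z β ≤ Real.exp ((ν₀ * Real.log 2 + C) * (L : ℝ) ^ 4) := by
    have hq : 0 < Z (β / 2) / Z β := div_pos (hZpos _) (hZpos _)
    rw [← Real.exp_log hq, Real.exp_le_exp, Real.log_div (hZpos _).ne' (hZpos _).ne']
    linarith
  calc ∫ U, ∏ p ∈ F, Real.exp (1 / 2 * β * plaqCost r.ρ U p) ∂(wilsonMeasure (d := 4) (L := L) r.ρ β)
      ≤ ∫ U, Real.exp ((β - β / 2) * wilsonAction r.ρ U) ∂(wilsonMeasure (d := 4) (L := L) r.ρ β) := h1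
    _ = Z (β / 2) / Z β := hR
    _ ≤ Real.exp ((ν₀ * Real.log 2 + C) * (L : ℝ) ^ 4) := h2

/-! ## §5 SEAM 2 (proved): (CB) + (EM) ⇒ (R-even) -/

section Seam2

variable {G : Type} [Group G] [TopologicalSpace G] [IsTopologicalGroup G] [CompactSpace G]
  [MeasurableSpace G] [BorelSpace G]

/-- The large-field set `E_t = {g | t < N − Re tr ρ g}` is measurable, conjugation- and inversion-invariant. -/
theorem largeSet_props (r : LatticeRep G) (t : ℝ) :
    MeasurableSet {g : G | t < (r.N : ℝ) - ((r.ρ g).trace).re} ∧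
      (∀ g h : G, h * g * h⁻¹ ∈ {g : G | t < (r.N : ℝ) - ((r.ρ g).trace).re} ↔
        g ∈ {g : G | t < (r.N : ℝ) - ((r.ρ g).trace).re}) ∧
      (∀ g : G, g⁻¹ ∈ {g : G | t < (r.N : ℝ) - ((r.ρ g).trace).re} ↔
        g ∈ {g : G | t < (r.N : ℝ) - ((r.ρ g).trace).re}) := by
  have hcont : Continuous fun g : G => (r.N : ℝ) - ((r.ρ g).trace).re :=
    continuous_const.sub (Complex.continuous_re.comp r.continuous.matrix_trace)
  refine ⟨(isOpen_lt continuous_const hcont).measurableSet, fun g h => ?_, fun g => ?_⟩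
  · simp only [Set.mem_setOf_eq,
      Literature.RepresentationTheory.CompactGroups.CompactGroup.trace_conj_eq r.ρ g h]
  · simp only [Set.mem_setOf_eq,
      Literature.RepresentationTheory.CompactGroups.CompactGroup.re_trace_map_inv r.ρ r.continuous g]

/-- **Exponential Chebyshev on the full array of one orientation**: `μ{∀ p ∈ o, s_p > A/(2β)} ≤ e^{-λ A L⁴/2} ⟨∏_{p∈o} e^{λβ s_p}⟩`. -/
theorem measureReal_orientation_le (r : LatticeRep G) {L : ℕ} [NeZero L] {β lam A : ℝ} (hβ : 0 < β) (hlam : 0 < lam)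
    (o : {q : Fin 4 × Fin 4 // q.1 < q.2}) :
    (wilsonMeasure (d := 4) (L := L) r.ρ β).real
        {U | ∀ p : Literature.MathematicalPhysics.QuantumFieldTheory.Plaquette 4 L, p.2 = o →
          plaquetteHolonomy U p.1 p.2.1.1 p.2.1.2 ∈ {g : G | A / (2 * β) < (r.N : ℝ) - ((r.ρ g).trace).re}} ≤
      Real.exp (-(lam * A / 2 * (L : ℝ) ^ 4)) *
        ∫ U, ∏ p ∈ (Finset.univ.filter fun p : Literature.MathematicalPhysics.QuantumFieldTheory.Plaquette 4 L => p.2 = o),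
          Real.exp (lam * β * plaqCost r.ρ U p) ∂(wilsonMeasure (d := 4) (L := L) r.ρ β) := by
  haveI := isProbabilityMeasure_wilsonMeasure (d := 4) (L := L) (G := G) r.ρ r.continuous β
  set Fo := (Finset.univ.filter fun p : Literature.MathematicalPhysics.QuantumFieldTheory.Plaquette 4 L => p.2 = o) with hFo
  set Sev : Set (GaugeConfig 4 L G) :=
    {U | ∀ p : Literature.MathematicalPhysics.QuantumFieldTheory.Plaquette 4 L, p.2 = o →
      plaquetteHolonomy U p.1 p.2.1.1 p.2.1.2 ∈ {g : G | A / (2 * β) < (r.N : ℝ) - ((r.ρ g).trace).re}} with hSev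
  -- cardinality of one orientation: `L⁴`
  have hcard : (Fo.card : ℝ) = (L : ℝ) ^ 4 := by
    have h1 : Fo = Finset.univ.image
        (fun x : Literature.MathematicalPhysics.QuantumFieldTheory.Site 4 L =>
          ((x, o) : Literature.MathematicalPhysics.QuantumFieldTheory.Plaquette 4 L)) := by
      ext p
      simp only [hFo, Finset.mem_filter, Finset.mem_univ, true_and, Finset.mem_image]
      constructor
      · intro hp; exact ⟨p.1, by rw [← hp]⟩
      · rintro ⟨x, rfl⟩; rfl
    rw [h1, Finset.card_image_of_injective _ (fun x y hxy => by simpa using congrArg Prod.fst hxy),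
      Finset.card_univ, Fintype.card_pi, Finset.prod_const, Finset.card_univ, Fintype.card_fin, ZMod.card]
    push_cast
    ring
  -- measurability of the event
  have hSm : MeasurableSet Sev := by
    have : Sev = ⋂ p ∈ Fo, {U | A / (2 * β) < plaqCost r.ρ U p} := by
      ext U
      simp only [hSev, hFo, Set.mem_setOf_eq, Set.mem_iInter, Finset.mem_filter, Finset.mem_univ, true_and, plaqCost]
    rw [this]
    exact MeasurableSet.biInter (Set.to_countable _) fun p _ =>
      measurableSet_lt measurable_const (measurable_plaqCost r p)
  -- the dominating function
  set g : GaugeConfig 4 L G → ℝ := fun U =>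
    Real.exp (-(lam * A / 2 * (L : ℝ) ^ 4)) * ∏ p ∈ Fo, Real.exp (lam * β * plaqCost r.ρ U p) with hg
  have hgm : Measurable g :=
    measurable_const.mul (Finset.measurable_prod _ fun p _ =>
      Real.measurable_exp.comp ((measurable_plaqCost r p).const_mul _))
  have hgb : ∀ U, ‖g U‖ ≤ Real.exp (-(lam * A / 2 * (L : ℝ) ^ 4)) * Real.exp (lam * β * (2 * r.N)) ^ Fo.card := by
    intro U
    have hg0 : 0 ≤ g U := mul_nonneg (Real.exp_pos _).le (Finset.prod_nonneg fun p _ => (Real.exp_pos _).le)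
    rw [Real.norm_eq_abs, abs_of_nonneg hg0, hg]
    refine mul_le_mul_of_nonneg_left ?_ (Real.exp_pos _).le
    rw [← Finset.prod_const]
    exact Finset.prod_le_prod (fun p _ => (Real.exp_pos _).le) fun p _ =>
      Real.exp_le_exp.2 (mul_le_mul_of_nonneg_left (plaqCost_le r U p) (by positivity))
  have hgi : Integrable g (wilsonMeasure (d := 4) (L := L) r.ρ β) :=
    (integrable_const _).mono' hgm.aestronglyMeasurable (ae_of_all _ hgb)
  -- pointwise: indicator ≤ g
  have hptw : ∀ U, Sev.indicator (fun _ => (1 : ℝ)) U ≤ g U := by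
    intro U
    by_cases hU : U ∈ Sev
    · rw [Set.indicator_of_mem hU, hg]
      have hexp : Real.exp (-(lam * A / 2 * (L : ℝ) ^ 4)) * Real.exp (lam * A / 2) ^ Fo.card = 1 := by
        rw [← Real.exp_nat_mul, ← Real.exp_add, hcard]
        convert Real.exp_zero using 2
        ring
      rw [← hexp]
      refine mul_le_mul_of_nonneg_left ?_ (Real.exp_pos _).le
      rw [← Finset.prod_const]
      refine Finset.prod_le_prod (fun p _ => (Real.exp_pos _).le) fun p hp => Real.exp_le_exp.2 ?_
      have hp' : p.2 = o := by simpa [hFo] using hp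
      have hlt : A / (2 * β) < plaqCost r.ρ U p := hU p hp'
      have : lam * A / 2 = lam * β * (A / (2 * β)) := by field_simp
      rw [this]
      exact mul_le_mul_of_nonneg_left hlt.le (by positivity)
    · rw [Set.indicator_of_notMem hU]
      exact mul_nonneg (Real.exp_pos _).le (Finset.prod_nonneg fun p _ => (Real.exp_pos _).le)
  calc (wilsonMeasure (d := 4) (L := L) r.ρ β).real Sev
      = ∫ U, Sev.indicator (fun _ => (1 : ℝ)) U ∂(wilsonMeasure (d := 4) (L := L) r.ρ β) :=
        (integral_indicator_one hSm).symm
    _ ≤ ∫ U, g U ∂(wilsonMeasure (d := 4) (L := L) r.ρ β) :=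
        integral_mono_of_nonneg (ae_of_all _ fun U => Set.indicator_nonneg (fun _ _ => zero_le_one) U) hgi
          (ae_of_all _ hptw)
    _ = _ := by rw [hg, integral_const_mul]

end Seam2

/-- **(CB) + (EM) ⇒ (R-even)**: on the full array of each orientation exponential Chebyshev and (EM) give
`μ{∀ p ∈ o, s_p > A/(2β)} ≤ e^{(C − λA/2)L⁴}`; the chessboard estimate raises this to the power `#Q_o/(6L⁴)` and multiplies
over the six orientations: `μ{∀ p ∈ Q, s_p > A/(2β)} ≤ e^{(C − λA/2)|Q|/6} ≤ e^{−(λ/24) A |Q|}` once `A ≥ 4C/λ`. -/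
theorem largeFieldRarityEven_of {fl : ℝ → ℕ} (hCB : ChessboardEvents) (hEM : ExpMomentBoundFrom fl) : LargeFieldRarityEvenFrom fl := by
  intro G _ _ _ _ hG
  letI : MeasurableSpace G := borel G
  haveI : BorelSpace G := ⟨rfl⟩
  intro r
  obtain ⟨lam, C, β₃, hlam, hβ₃, hem⟩ := hEM G hG r
  refine ⟨lam / 24, 4 * C / lam, β₃, by positivity, ?_⟩
  intro A hA β hβ L _ hLeven hL Q
  have hβpos : 0 < β := lt_of_lt_of_le hβ₃ hβ
  haveI := isProbabilityMeasure_wilsonMeasure (d := 4) (L := L) (G := G) r.ρ r.continuous β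
  have hLnat : 0 < L := Nat.pos_of_ne_zero (NeZero.ne L)
  have hLr : (0 : ℝ) < (L : ℝ) := Nat.cast_pos.2 hLnat
  have hLpos : (0 : ℝ) < (L : ℝ) ^ 4 := by positivity
  -- the large-field set
  set E : Set G := {g : G | A / (2 * β) < (r.N : ℝ) - ((r.ρ g).trace).re} with hE
  obtain ⟨hEm, hEconj, hEinv⟩ := largeSet_props r (A / (2 * β))
  -- chessboard
  have hcb := hCB G r L hLeven β hβpos.le E hEm hEconj hEinv Q
  -- per orientation bound
  have horient : ∀ o : {q : Fin 4 × Fin 4 // q.1 < q.2},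
      (wilsonMeasure (d := 4) (L := L) r.ρ β).real
          {U | ∀ p : Literature.MathematicalPhysics.QuantumFieldTheory.Plaquette 4 L, p.2 = o →
            plaquetteHolonomy U p.1 p.2.1.1 p.2.1.2 ∈ E} ≤
        Real.exp ((C - lam * A / 2) * (L : ℝ) ^ 4) := by
    intro o
    have h1 := measureReal_orientation_le r (L := L) (A := A) hβpos hlam o
    have h2 := hem L β hβ hL (Finset.univ.filter fun p => p.2 = o)
    calc _ ≤ Real.exp (-(lam * A / 2 * (L : ℝ) ^ 4)) * Real.exp (C * (L : ℝ) ^ 4) :=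
          h1.trans (mul_le_mul_of_nonneg_left h2 (Real.exp_pos _).le)
      _ = Real.exp ((C - lam * A / 2) * (L : ℝ) ^ 4) := by rw [← Real.exp_add]; ring_nf
  -- combine
  have hpow : ∀ o : {q : Fin 4 × Fin 4 // q.1 < q.2},
      ((wilsonMeasure (d := 4) (L := L) r.ρ β).real
          {U | ∀ p : Literature.MathematicalPhysics.QuantumFieldTheory.Plaquette 4 L, p.2 = o →
            plaquetteHolonomy U p.1 p.2.1.1 p.2.1.2 ∈ E}) ^
          (((Q.filter fun p => p.2 = o).card : ℝ) / (6 * (L : ℝ) ^ 4)) ≤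
        Real.exp ((C - lam * A / 2) / 6 * ((Q.filter fun p => p.2 = o).card : ℝ)) := by
    intro o
    have hexp : 0 ≤ (((Q.filter fun p => p.2 = o).card : ℝ) / (6 * (L : ℝ) ^ 4)) := by positivity
    calc _ ≤ (Real.exp ((C - lam * A / 2) * (L : ℝ) ^ 4)) ^
            (((Q.filter fun p => p.2 = o).card : ℝ) / (6 * (L : ℝ) ^ 4)) :=
          Real.rpow_le_rpow measureReal_nonneg (horient o) hexp
      _ = Real.exp ((C - lam * A / 2) / 6 * ((Q.filter fun p => p.2 = o).card : ℝ)) := by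
          rw [← Real.exp_mul]
          congr 1
          field_simp
  have hprod : ∏ o : {q : Fin 4 × Fin 4 // q.1 < q.2},
      ((wilsonMeasure (d := 4) (L := L) r.ρ β).real
          {U | ∀ p : Literature.MathematicalPhysics.QuantumFieldTheory.Plaquette 4 L, p.2 = o →
            plaquetteHolonomy U p.1 p.2.1.1 p.2.1.2 ∈ E}) ^
          (((Q.filter fun p => p.2 = o).card : ℝ) / (6 * (L : ℝ) ^ 4)) ≤
        Real.exp ((C - lam * A / 2) / 6 * (Q.card : ℝ)) := by
    calc _ ≤ ∏ o : {q : Fin 4 × Fin 4 // q.1 < q.2},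
            Real.exp ((C - lam * A / 2) / 6 * ((Q.filter fun p => p.2 = o).card : ℝ)) :=
          Finset.prod_le_prod (fun o _ => Real.rpow_nonneg measureReal_nonneg _) fun o _ => hpow o
      _ = Real.exp ((C - lam * A / 2) / 6 * (Q.card : ℝ)) := by
          rw [← Real.exp_sum, ← Finset.mul_sum]
          congr 2
          rw [Finset.card_eq_sum_card_fiberwise (f := fun p : Literature.MathematicalPhysics.QuantumFieldTheory.Plaquette 4 L => p.2)
            (t := Finset.univ) (fun p _ => Finset.mem_univ _)]
          push_cast
          rfl
  -- the rate
  have hrate : (C - lam * A / 2) / 6 * (Q.card : ℝ) ≤ -(lam / 24 * A * Q.card) := by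
    have hA' : 4 * C ≤ lam * A := by
      have := (div_le_iff₀ hlam).1 hA
      linarith
    have hQ : (0 : ℝ) ≤ Q.card := Nat.cast_nonneg _
    nlinarith
  -- conclude
  have hreal : (wilsonMeasure (d := 4) (L := L) r.ρ β).real {U | ∀ p ∈ Q, A / (2 * β) < plaqCost r.ρ U p} ≤
      Real.exp (-(lam / 24 * A * Q.card)) := by
    have hset : {U : GaugeConfig 4 L G | ∀ p ∈ Q, A / (2 * β) < plaqCost r.ρ U p} =
        {U | ∀ p ∈ Q, plaquetteHolonomy U p.1 p.2.1.1 p.2.1.2 ∈ E} := by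
      ext U; simp only [Set.mem_setOf_eq, hE, plaqCost]
    rw [hset]
    exact hcb.trans (hprod.trans (Real.exp_le_exp.2 hrate))
  rw [← ENNReal.ofReal_toReal (measure_ne_top _ _)]
  exact ENNReal.ofReal_le_ofReal hreal

/-! ## §6 SEAM 3 (proved, parity-agnostic): (CZ on 𝓛) + (FE) ⇒ (R on 𝓛) — Chebyshev FIRST, then chessboard on the exponential functional -/

section Seam3

variable {G : Type} [Group G] [TopologicalSpace G] [IsTopologicalGroup G] [CompactSpace G]
  [MeasurableSpace G] [BorelSpace G]

/-- **Exponential Chebyshev on `Q` itself**: `μ{∀ p ∈ Q, s_p > A/(2β)} ≤ e^{-λA|Q|/2} ⟨∏_{p∈Q} e^{λβ s_p}⟩`. -/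
theorem measureReal_largeField_le (r : LatticeRep G) {L : ℕ} [NeZero L] {β lam A : ℝ} (hβ : 0 < β) (hlam : 0 < lam)
    (Q : Finset (Literature.MathematicalPhysics.QuantumFieldTheory.Plaquette 4 L)) :
    (wilsonMeasure (d := 4) (L := L) r.ρ β).real {U | ∀ p ∈ Q, A / (2 * β) < plaqCost r.ρ U p} ≤
      Real.exp (-(lam * A / 2 * Q.card)) *
        ∫ U, ∏ p ∈ Q, Real.exp (lam * β * plaqCost r.ρ U p) ∂(wilsonMeasure (d := 4) (L := L) r.ρ β) := by
  haveI := isProbabilityMeasure_wilsonMeasure (d := 4) (L := L) (G := G) r.ρ r.continuous β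
  set Sev : Set (GaugeConfig 4 L G) := {U | ∀ p ∈ Q, A / (2 * β) < plaqCost r.ρ U p} with hSev
  have hSm : MeasurableSet Sev := by
    have : Sev = ⋂ p ∈ Q, {U | A / (2 * β) < plaqCost r.ρ U p} := by
      ext U; simp only [hSev, Set.mem_setOf_eq, Set.mem_iInter]
    rw [this]
    exact MeasurableSet.biInter (Set.to_countable _) fun p _ =>
      measurableSet_lt measurable_const (measurable_plaqCost r p)
  set g : GaugeConfig 4 L G → ℝ := fun U =>
    Real.exp (-(lam * A / 2 * Q.card)) * ∏ p ∈ Q, Real.exp (lam * β * plaqCost r.ρ U p) with hg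
  have hgm : Measurable g :=
    measurable_const.mul (Finset.measurable_prod _ fun p _ =>
      Real.measurable_exp.comp ((measurable_plaqCost r p).const_mul _))
  have hgb : ∀ U, ‖g U‖ ≤ Real.exp (-(lam * A / 2 * Q.card)) * Real.exp (lam * β * (2 * r.N)) ^ Q.card := by
    intro U
    have hg0 : 0 ≤ g U := mul_nonneg (Real.exp_pos _).le (Finset.prod_nonneg fun p _ => (Real.exp_pos _).le)
    rw [Real.norm_eq_abs, abs_of_nonneg hg0, hg]
    refine mul_le_mul_of_nonneg_left ?_ (Real.exp_pos _).le
    rw [← Finset.prod_const]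
    exact Finset.prod_le_prod (fun p _ => (Real.exp_pos _).le) fun p _ =>
      Real.exp_le_exp.2 (mul_le_mul_of_nonneg_left (plaqCost_le r U p) (by positivity))
  have hgi : Integrable g (wilsonMeasure (d := 4) (L := L) r.ρ β) :=
    (integrable_const _).mono' hgm.aestronglyMeasurable (ae_of_all _ hgb)
  have hptw : ∀ U, Sev.indicator (fun _ => (1 : ℝ)) U ≤ g U := by
    intro U
    by_cases hU : U ∈ Sev
    · rw [Set.indicator_of_mem hU, hg]
      have hexp : Real.exp (-(lam * A / 2 * Q.card)) * Real.exp (lam * A / 2) ^ Q.card = 1 := by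
        rw [← Real.exp_nat_mul, ← Real.exp_add]
        convert Real.exp_zero using 2
        ring
      rw [← hexp]
      refine mul_le_mul_of_nonneg_left ?_ (Real.exp_pos _).le
      rw [← Finset.prod_const]
      refine Finset.prod_le_prod (fun p _ => (Real.exp_pos _).le) fun p hp => Real.exp_le_exp.2 ?_
      have hlt : A / (2 * β) < plaqCost r.ρ U p := hU p hp
      have : lam * A / 2 = lam * β * (A / (2 * β)) := by field_simp
      rw [this]
      exact mul_le_mul_of_nonneg_left hlt.le (by positivity)
    · rw [Set.indicator_of_notMem hU]
      exact mul_nonneg (Real.exp_pos _).le (Finset.prod_nonneg fun p _ => (Real.exp_pos _).le)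
  calc (wilsonMeasure (d := 4) (L := L) r.ρ β).real Sev
      = ∫ U, Sev.indicator (fun _ => (1 : ℝ)) U ∂(wilsonMeasure (d := 4) (L := L) r.ρ β) :=
        (integral_indicator_one hSm).symm
    _ ≤ ∫ U, g U ∂(wilsonMeasure (d := 4) (L := L) r.ρ β) :=
        integral_mono_of_nonneg (ae_of_all _ fun U => Set.indicator_nonneg (fun _ _ => zero_le_one) U) hgi
          (ae_of_all _ hptw)
    _ = _ := by rw [hg, integral_const_mul]

end Seam3

/-- **(CZ on 𝓛) + (FE) ⇒ (R on 𝓛)**, every side class: exponential Chebyshev on `Q`, the chessboard-to-free-energy bound, and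
the free-energy increment at `β' = (1−kθ)β`: `μ{∀ p ∈ Q, s_p > A/(2β)} ≤ e^{(−θA/2 + C₁)|Q|} ≤ e^{−(θ/4)A|Q|}` for `A ≥ 4C₁/θ`,
`C₁ = (ν₀ log(1/(1−kθ)) + C)/k`, `β ≥ β₃/(1−kθ)`, `L ≥ L₀(β)`, `L ∈ 𝓛`. -/
theorem largeFieldRarityOn_of_ZRatio {𝓛 : Set ℕ} {fl : ℝ → ℕ} (hCZ : ChessboardZRatio 𝓛) (hFE : FreeEnergyIncrementFrom fl) :
    LargeFieldRarityOnFrom 𝓛 fl := by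
  intro G _ _ _ _ hG
  letI : MeasurableSpace G := borel G
  haveI : BorelSpace G := ⟨rfl⟩
  intro r
  obtain ⟨k, θ, hθ, hk, hkθ, hcz⟩ := hCZ G r
  obtain ⟨ν₀, C, β₃, hβ₃, hinc⟩ := hFE G hG r
  have hk0 : 0 < k := lt_of_lt_of_le one_pos hk
  have h1kθ : 0 < 1 - k * θ := by linarith
  set C₁ : ℝ := (ν₀ * Real.log (1 / (1 - k * θ)) + C) / k with hC₁
  refine ⟨θ / 4, 4 * C₁ / θ, β₃ / (1 - k * θ), by positivity, ?_⟩
  intro A hA β hβ L _ hL𝓛 hL Q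
  have hβ₃' : β₃ ≤ β := by
    have h1 : β₃ / (1 - k * θ) ≥ β₃ := by
      rw [ge_iff_le, le_div_iff₀ h1kθ]
      nlinarith [mul_pos (mul_pos hβ₃ hk0) hθ]
    linarith
  have hβpos : 0 < β := lt_of_lt_of_le hβ₃ hβ₃'
  haveI := isProbabilityMeasure_wilsonMeasure (d := 4) (L := L) (G := G) r.ρ r.continuous β
  have hLnat : 0 < L := Nat.pos_of_ne_zero (NeZero.ne L)
  have hLr : (0 : ℝ) < (L : ℝ) := Nat.cast_pos.2 hLnat
  have hL4 : (0 : ℝ) < (L : ℝ) ^ 4 := by positivity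
  -- Chebyshev
  have h1 := measureReal_largeField_le r (L := L) (A := A) hβpos hθ Q
  -- chessboard-to-free-energy at `lam = θ`
  have h2 := hcz L hL𝓛 β hβpos.le θ hθ le_rfl Q
  -- free-energy increment between `(1-kθ)β` and `β`
  have h3 : torusLogPartition 4 r.ρ ((1 - k * θ) * β) L - torusLogPartition 4 r.ρ β L ≤
      (ν₀ * Real.log (1 / (1 - k * θ)) + C) * (L : ℝ) ^ 4 := by
    have hb1 : β₃ ≤ (1 - k * θ) * β := by
      have := (div_le_iff₀ h1kθ).1 hβ
      linarith
    have hb2 : (1 - k * θ) * β ≤ β := by nlinarith [mul_pos (mul_pos hk0 hθ) hβpos]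
    have h := hinc L ((1 - k * θ) * β) β hb1 hb2 hL
    have hdiv : β / ((1 - k * θ) * β) = 1 / (1 - k * θ) := by
      field_simp
    rw [hdiv] at h
    linarith
  -- combine
  have hQ : (0 : ℝ) ≤ Q.card := Nat.cast_nonneg _
  have h4 : ∫ U, ∏ p ∈ Q, Real.exp (θ * β * plaqCost r.ρ U p) ∂(wilsonMeasure (d := 4) (L := L) r.ρ β) ≤
      Real.exp (C₁ * Q.card) := by
    refine h2.trans (Real.exp_le_exp.2 ?_)
    have hexp : 0 ≤ (Q.card : ℝ) / (k * (L : ℝ) ^ 4) := by positivity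
    calc (torusLogPartition 4 r.ρ ((1 - k * θ) * β) L - torusLogPartition 4 r.ρ β L) * ((Q.card : ℝ) / (k * (L : ℝ) ^ 4))
        ≤ (ν₀ * Real.log (1 / (1 - k * θ)) + C) * (L : ℝ) ^ 4 * ((Q.card : ℝ) / (k * (L : ℝ) ^ 4)) :=
          mul_le_mul_of_nonneg_right h3 hexp
      _ = C₁ * Q.card := by rw [hC₁]; field_simp
  have hrate : -(θ * A / 2 * Q.card) + C₁ * Q.card ≤ -(θ / 4 * A * Q.card) := by
    have hA' : 4 * C₁ ≤ θ * A := by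
      have := (div_le_iff₀ hθ).1 hA
      linarith
    nlinarith
  have hreal : (wilsonMeasure (d := 4) (L := L) r.ρ β).real {U | ∀ p ∈ Q, A / (2 * β) < plaqCost r.ρ U p} ≤
      Real.exp (-(θ / 4 * A * Q.card)) :=
    calc _ ≤ Real.exp (-(θ * A / 2 * Q.card)) * Real.exp (C₁ * Q.card) :=
          h1.trans (mul_le_mul_of_nonneg_left h4 (Real.exp_pos _).le)
      _ = Real.exp (-(θ * A / 2 * Q.card) + C₁ * Q.card) := by rw [Real.exp_add]
      _ ≤ Real.exp (-(θ / 4 * A * Q.card)) := Real.exp_le_exp.2 hrate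
  rw [← ENNReal.ofReal_toReal (measure_ne_top _ _)]
  exact ENNReal.ofReal_le_ofReal hreal

/-! ## §6b (proved): (CZ-odd) IS the tree's odd-torus chessboard (ym-infvol-p3, 2026-08-27) -/

/-- **(CZ) on the odd sides `≥ 3`, PROVED**: `OddTorusChessboard.wilsonExpectation_expObs_le_exp_card_all` (Hölder over the
`m = 6` orientations + the odd-torus one-orientation chessboard from the MIXED site|link reflections, Borgs–Seiler) is exactly
`ChessboardZRatio {L | Odd L ∧ 3 ≤ L}` with `k = m`, `θ = 1/(2m)`, after `∏ e^{λβ s_p} = e^{λβ Σ s_p}`. -/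
theorem chessboardZRatio_odd : ChessboardZRatio {L | Odd L ∧ 3 ≤ L} := by
  intro G _ _ _ _
  letI : MeasurableSpace G := borel G
  haveI : BorelSpace G := ⟨rfl⟩
  intro r
  have hmpos : 0 < Fintype.card (OddTorusChessboard.Orient 4) :=
    Fintype.card_pos_iff.2 ⟨⟨((0 : Fin 4), (1 : Fin 4)), by decide⟩⟩
  set m : ℕ := Fintype.card (OddTorusChessboard.Orient 4) with hm
  have hmR : (0 : ℝ) < m := by exact_mod_cast hmpos
  have hm1 : (1 : ℝ) ≤ m := by exact_mod_cast hmpos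
  have hθ : (m : ℝ) * (1 / (2 * m)) = 1 / 2 := by field_simp
  refine ⟨m, 1 / (2 * m), by positivity, hm1, by rw [hθ]; norm_num, ?_⟩
  intro L _ hL β hβ lam hlam hlamθ Q
  obtain ⟨hLodd, hL3⟩ := hL
  have hc : 0 ≤ lam * β := mul_nonneg hlam.le hβ
  have hmlam : (m : ℝ) * lam ≤ 1 := by
    have h := mul_le_mul_of_nonneg_left hlamθ hmR.le
    rw [hθ] at h
    linarith
  have hmc : (m : ℝ) * (lam * β) ≤ β := by
    calc (m : ℝ) * (lam * β) = (m * lam) * β := by ring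
      _ ≤ 1 * β := mul_le_mul_of_nonneg_right hmlam hβ
      _ = β := one_mul β
  have key := OddTorusChessboard.wilsonExpectation_expObs_le_exp_card_all (d := 4) (L := L) r.ρ hLodd hL3 r.continuous
    hc hmc hmpos Q
  have hlhs : ∫ U, ∏ p ∈ Q, Real.exp (lam * β * plaqCost r.ρ U p) ∂(wilsonMeasure (d := 4) (L := L) r.ρ β) =
      wilsonExpectation r.ρ β (SoloBlind.expObs r.ρ (lam * β) Q) := by
    unfold wilsonExpectation SoloBlind.expObs
    congr 1
    funext U
    rw [Finset.mul_sum, Real.exp_sum]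
    rfl
  rw [hlhs]
  refine key.trans (le_of_eq ?_)
  congr 1
  rw [show β - (m : ℝ) * (lam * β) = (1 - m * lam) * β by ring, mul_comm]

/-! ## §7 Outputs of the engine — THEOREMS (no hypotheses on the odd sides; (CB) as a hypothesis on the even sides) -/

/-- `LargeFieldRarityEven` is `LargeFieldRarityOn` at the even sides (definitional). -/
theorem largeFieldRarityEven_of_on {fl : ℝ → ℕ} (h : LargeFieldRarityOnFrom {L | Even L} fl) : LargeFieldRarityEvenFrom fl := by
  intro G _ _ _ _ hG
  letI : MeasurableSpace G := borel G
  haveI : BorelSpace G := ⟨rfl⟩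
  intro r
  obtain ⟨c, A₀, β₃, hc, hh⟩ := h G hG r
  exact ⟨c, A₀, β₃, hc, fun A hA β hβ L _ hLe hL Q => hh A hA β hβ L hLe hL Q⟩

/-- **MAIN THEOREM (odd tori of the literal crux; no hypotheses, no `sorry`)**: fixed-`A`, β-uniform, Peierls-multiplicative
large-field rarity on every odd torus `L ≥ max(3, (⌈β⌉₊+2)²)`, for every compact simple `G` — reflection positivity by the tree's
odd-torus chessboard, β-uniformity by the tree's Chatterjee theorem + (FS).  Versus LINE 3's literal `stub_largeFieldRarity`
(= `LargeFieldRarityOdd`): `∃ A₀ ∀ A ≥ A₀` with one rate instead of `∀ A > 0 ∃ c`, sides `≥ 3`, and the volume floor `(⌈β⌉₊+2)²`;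
all three are what a Peierls count of SPARSE defects on tori `≥ M₁(β)` consumes (recommended re-typing of LINE 3's (R)). -/
theorem largeFieldRarity_oddSides : LargeFieldRarityOn {L | Odd L ∧ 3 ≤ L} :=
  largeFieldRarityOn_of_ZRatio chessboardZRatio_odd (freeEnergyIncrement_of_thermo freeEnergyThermo finiteSizeFreeEnergy)

/-- **MAIN THEOREM, explicit form in the crux's parametrisation `𝕋⁴_{2S+1}`, `S ≥ 1`** (witness of `LargeFieldRarityOddTori`). -/
theorem largeFieldRarityOddTori_holds : LargeFieldRarityOddTori := by
  intro G _ _ _ _ hG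
  letI : MeasurableSpace G := borel G
  haveI : BorelSpace G := ⟨rfl⟩
  intro r
  obtain ⟨c, A₀, β₃, hc, hh⟩ := largeFieldRarity_oddSides G hG r
  refine ⟨c, A₀, β₃, hc, fun A hA β hβ S hS hL Q => ?_⟩
  exact hh A hA β hβ (2 * S + 1) ⟨⟨S, rfl⟩, by omega⟩ hL Q

/-- **(R♭) `LargeFieldRarityFrom` — VERBATIM the statement PROVED FIRST by the parallel seat ym-ir-idea-5 g6**
(`Cruxes/IR/Lines/largefield_rarity_uniform.lean`, `largeFieldRarityFrom_holds`, 2026-08-28T02:43Z; same lever: odd-torus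
chessboard × the tree's Chatterjee theorem, volume floor `S₁(β)` NON-explicit from the thermodynamic limit at each `β`).  Recorded
so that both supplier files are seen to discharge ONE statement; implied by `LargeFieldRarityOddTori` (explicit floor, constants
uniform in `A`) — `largeFieldRarityFrom_of_oddTori`. -/
def LargeFieldRarityFrom : Prop :=
  ∀ (G : Type) [Group G] [TopologicalSpace G] [IsTopologicalGroup G] [CompactSpace G],
    IsCompactSimpleLieGroup G →
    letI : MeasurableSpace G := borel G
    haveI : BorelSpace G := ⟨rfl⟩
    ∀ (r : LatticeRep G), ∃ A₀ : ℝ, ∀ A : ℝ, A₀ < A → ∃ (c β₃ : ℝ) (S₁ : ℝ → ℕ), 0 < c ∧ ∀ β : ℝ, β₃ ≤ β →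
      ∀ (S : ℕ), S₁ β ≤ S → ∀ (Q : Finset (Literature.MathematicalPhysics.QuantumFieldTheory.Plaquette 4 (2 * S + 1))),
        wilsonMeasure (d := 4) (L := 2 * S + 1) r.ρ β
            {U | ∀ p ∈ Q, A / (2 * β) < plaquetteCost r.ρ U p} ≤
          ENNReal.ofReal (Real.exp (-(c * A * Q.card)))

/-- `LargeFieldRarityOddTori → LargeFieldRarityFrom` (`S₁ β := max 1 (volFloor β)`; `plaqCost = plaquetteCost` is `rfl`). -/
theorem largeFieldRarityFrom_of_oddTori (h : LargeFieldRarityOddTori) : LargeFieldRarityFrom := by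
  intro G _ _ _ _ hG
  letI : MeasurableSpace G := borel G
  haveI : BorelSpace G := ⟨rfl⟩
  intro r
  obtain ⟨c, A₀, β₃, hc, hh⟩ := h G hG r
  refine ⟨A₀, fun A hA => ⟨c, β₃, fun β => max 1 (volFloor β), hc, fun β hβ S hS Q => ?_⟩⟩
  have hS1 : 1 ≤ S := le_trans (le_max_left _ _) hS
  have hSf : volFloor β ≤ 2 * S + 1 := by have := le_trans (le_max_right _ _) hS; omega
  exact hh A hA.le β hβ S hS1 hSf Q

/-- Hence `LargeFieldRarityFrom` holds (second, independent proof of idea-5's statement). -/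
theorem largeFieldRarityFrom_holds' : LargeFieldRarityFrom :=
  largeFieldRarityFrom_of_oddTori largeFieldRarityOddTori_holds

/-- **Even sides (e.g. the class-parametric leg's `familySides`), from an even indicator chessboard (CB) as hypothesis.** -/
theorem largeFieldRarity_even (hCB : ChessboardEvents) : LargeFieldRarityEven :=
  largeFieldRarityEven_of hCB (expMomentBound_of_increment (freeEnergyIncrement_of_thermo freeEnergyThermo finiteSizeFreeEnergy))

/-! ## §8 Below the floor: the typed residual (FE<) and what it buys — LINE 3's (R) on ALL odd tori `≥ 3` -/

/-- **(FE<) FREE-ENERGY INCREMENT BELOW THE FLOOR** (OPEN, research M; the typed residual behind LINE 3's (R<)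
`stub_largeFieldRaritySmallTori`): the increment bound of (FE) on the tori of side `1 ≤ L < volFloor β = (⌈β⌉₊+2)²`, uniformly.
Content: finite-torus Laplace asymptotics with an `O(L⁴)`-sharp Gaussian mode count — an UPPER bound `log Z_L(β') ≤ −ν_L log β' + K_L
+ C L⁴` (Gaussian domination with the exact number `ν_L = νL⁴ + O(1)` of transverse modes, flat zero-modes ∕ torons contributing
`β⁰`; the research half) and a LOWER bound `log Z_L(β) ≥ −ν_L log β + K_L − C L⁴` (tree-gauge Gaussian ball, elementary:
`HaarSmallBallClosedSubgroup`-type); per-degree-of-freedom accuracy `O(1)` suffices, no smallness in `L/β`.  Cheapest falsifier: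
`SU(2)`, `L = 3`, character expansion of `log Z_3(β) − log Z_3(β/2)` (idea-5 g6's proposal). -/
def FreeEnergyIncrementBelow : Prop :=
  ∀ (G : Type) [Group G] [TopologicalSpace G] [IsTopologicalGroup G] [CompactSpace G],
    IsCompactSimpleLieGroup G →
    letI : MeasurableSpace G := borel G
    haveI : BorelSpace G := ⟨rfl⟩
    ∀ (r : LatticeRep G), ∃ (ν₀ C β₃ : ℝ), 0 < β₃ ∧
      ∀ (L : ℕ) [NeZero L] (β' β : ℝ), β₃ ≤ β' → β' ≤ β → L < volFloor β →
        torusLogPartition 4 r.ρ β' L - torusLogPartition 4 r.ρ β L ≤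
          ν₀ * (L : ℝ) ^ 4 * Real.log (β / β') + C * (L : ℝ) ^ 4

/-- **(FE above the floor) + (FE<) ⇒ (FE) on ALL tori** (floor `0`; constants merged by `max`). -/
theorem freeEnergyIncrementFrom_zero_of_below (hFE : FreeEnergyIncrement) (hB : FreeEnergyIncrementBelow) :
    FreeEnergyIncrementFrom (fun _ => 0) := by
  intro G _ _ _ _ hG
  letI : MeasurableSpace G := borel G
  haveI : BorelSpace G := ⟨rfl⟩
  intro r
  obtain ⟨ν₁, C₁, β₁, hβ₁, h₁⟩ := (hFE : FreeEnergyIncrementFrom volFloor) G hG r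
  obtain ⟨ν₂, C₂, β₂, hβ₂, h₂⟩ := hB G hG r
  refine ⟨max ν₁ ν₂, max C₁ C₂, max β₁ β₂, lt_of_lt_of_le hβ₁ (le_max_left _ _), ?_⟩
  intro L _ β' β hβ' hβ'β _
  have hβ'pos : 0 < β' := lt_of_lt_of_le (lt_of_lt_of_le hβ₁ (le_max_left _ _)) hβ'
  have hlog : 0 ≤ Real.log (β / β') := Real.log_nonneg ((one_le_div hβ'pos).2 hβ'β)
  have hL4 : (0 : ℝ) ≤ (L : ℝ) ^ 4 := by positivity
  have mono : ∀ ν C : ℝ, ν ≤ max ν₁ ν₂ → C ≤ max C₁ C₂ →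
      ν * (L : ℝ) ^ 4 * Real.log (β / β') + C * (L : ℝ) ^ 4 ≤
        max ν₁ ν₂ * (L : ℝ) ^ 4 * Real.log (β / β') + max C₁ C₂ * (L : ℝ) ^ 4 := by
    intro ν C hν hC
    have t1 : ν * (L : ℝ) ^ 4 * Real.log (β / β') ≤ max ν₁ ν₂ * (L : ℝ) ^ 4 * Real.log (β / β') :=
      mul_le_mul_of_nonneg_right (mul_le_mul_of_nonneg_right hν hL4) hlog
    have t2 : C * (L : ℝ) ^ 4 ≤ max C₁ C₂ * (L : ℝ) ^ 4 := mul_le_mul_of_nonneg_right hC hL4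
    linarith
  by_cases hfl : volFloor β ≤ L
  · exact le_trans (h₁ L β' β (le_trans (le_max_left _ _) hβ') hβ'β hfl) (mono ν₁ C₁ (le_max_left _ _) (le_max_left _ _))
  · exact le_trans (h₂ L β' β (le_trans (le_max_right _ _) hβ') hβ'β (lt_of_not_ge hfl))
      (mono ν₂ C₂ (le_max_right _ _) (le_max_right _ _))

/-- **LINE 3's (R) as re-typed in rev 3** (`SmallFieldPolymerCoder.LargeFieldRarity`, VERBATIM up to namespace): ALL odd tori `≥ 3`,
no volume floor, one rate for `A ≥ A₀`. -/
def LargeFieldRarityAllOddTori : Prop :=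
  ∀ (G : Type) [Group G] [TopologicalSpace G] [IsTopologicalGroup G] [CompactSpace G],
    IsCompactSimpleLieGroup G →
    letI : MeasurableSpace G := borel G
    haveI : BorelSpace G := ⟨rfl⟩
    ∀ (r : LatticeRep G), ∃ (c A₀ β₃ : ℝ), 0 < c ∧
      ∀ A : ℝ, A₀ ≤ A → ∀ β : ℝ, β₃ ≤ β → ∀ S : ℕ, 1 ≤ S →
        ∀ Q : Finset (Literature.MathematicalPhysics.QuantumFieldTheory.Plaquette 4 (2 * S + 1)),
          wilsonMeasure (d := 4) (L := 2 * S + 1) r.ρ β {U | ∀ p ∈ Q, A / (2 * β) < plaqCost r.ρ U p} ≤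
            ENNReal.ofReal (Real.exp (-(c * A * Q.card)))

/-- **LINE 3's (R<)** (`SmallFieldPolymerCoder.LargeFieldRaritySmallTori`, VERBATIM up to namespace): the small odd tori only. -/
def LargeFieldRaritySmallTori : Prop :=
  ∀ (G : Type) [Group G] [TopologicalSpace G] [IsTopologicalGroup G] [CompactSpace G],
    IsCompactSimpleLieGroup G →
    letI : MeasurableSpace G := borel G
    haveI : BorelSpace G := ⟨rfl⟩
    ∀ (r : LatticeRep G), ∃ (c A₀ β₃ : ℝ), 0 < c ∧
      ∀ A : ℝ, A₀ ≤ A → ∀ β : ℝ, β₃ ≤ β → ∀ S : ℕ, 1 ≤ S → 2 * S + 1 < volFloor β →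
        ∀ Q : Finset (Literature.MathematicalPhysics.QuantumFieldTheory.Plaquette 4 (2 * S + 1)),
          wilsonMeasure (d := 4) (L := 2 * S + 1) r.ρ β {U | ∀ p ∈ Q, A / (2 * β) < plaqCost r.ρ U p} ≤
            ENNReal.ofReal (Real.exp (-(c * A * Q.card)))

/-- **(FE<) ⇒ LINE 3's (R) on ALL odd tori `≥ 3`** — the same engine with floor `0`: `chessboardZRatio_odd` +
`largeFieldRarityOn_of_ZRatio` + `freeEnergyIncrementFrom_zero_of_below`.  So (R<) — and with it the whole of LINE 3's (R) — REDUCES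
BY NAME to the free-energy statement (FE<). -/
theorem largeFieldRarityAllOddTori_of_below (hB : FreeEnergyIncrementBelow) : LargeFieldRarityAllOddTori := by
  have h : LargeFieldRarityOnFrom {L | Odd L ∧ 3 ≤ L} (fun _ => 0) :=
    largeFieldRarityOn_of_ZRatio chessboardZRatio_odd
      (freeEnergyIncrementFrom_zero_of_below (freeEnergyIncrement_of_thermo freeEnergyThermo finiteSizeFreeEnergy) hB)
  intro G _ _ _ _ hG
  letI : MeasurableSpace G := borel G
  haveI : BorelSpace G := ⟨rfl⟩
  intro r
  obtain ⟨c, A₀, β₃, hc, hh⟩ := h G hG r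
  refine ⟨c, A₀, β₃, hc, fun A hA β hβ S hS Q => ?_⟩
  haveI : NeZero (2 * S + 1) := ⟨by omega⟩
  have hmem : (2 * S + 1) ∈ {L : ℕ | Odd L ∧ 3 ≤ L} := ⟨⟨S, by ring⟩, by omega⟩
  exact hh A hA β hβ (2 * S + 1) hmem (Nat.zero_le _) Q

/-- (FE<) ⇒ (R<) in particular. -/
theorem largeFieldRaritySmallTori_of_below (hB : FreeEnergyIncrementBelow) : LargeFieldRaritySmallTori := by
  intro G _ _ _ _ hG
  letI : MeasurableSpace G := borel G
  haveI : BorelSpace G := ⟨rfl⟩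
  intro r
  obtain ⟨c, A₀, β₃, hc, hh⟩ := largeFieldRarityAllOddTori_of_below hB G hG r
  exact ⟨c, A₀, β₃, hc, fun A hA β hβ S hS _ Q => hh A hA β hβ S hS Q⟩

end Summit.QuantumFields.YangMills.Cruxes.IR.LargeFieldRarityChessboard

end
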